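import Mathlib
import Literature.Combinatorics.Kakeya.KakeyaMethodOfMultiplicities
import HarnessLib

/-!
# Furstenberg sets over finite fields: `K(q, n, k, m) ≥ m^{n/k}/2ⁿ` via min-entropy
# (Dhar–Dvir–Lund 2021, Theorems 1, 4, 17, 18, 19 and Lemmas 12, 15, 16)

Topic `Literature/Combinatorics/Kakeya`.  Everything in this file is PROVED (no named fact, no
`sorry`).  It continues the finite-field thread of this directory (`FiniteFieldKakeya.lean`,
`KakeyaMultiplicityBound.lean`, `KakeyaMethodOfMultiplicities.lean`, `KakeyaSharpDensityBound.lean`)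
from Kakeya sets (`k = 1`, `m = q`) to `(k, m)`-Furstenberg sets, with the elementary proof of
Dhar, Dvir and Lund: the extended method of multiplicities of Dvir–Kopparty–Saraf–Sudan run with
point-dependent multiplicities (an `ℓⁿ` estimate for weighted Kakeya configurations), recast as a
statement about the min-entropy of linear images of a random variable, and iterated.

M. Dhar, Z. Dvir, B. Lund, *Simple proofs for Furstenberg sets over finite fields*, Discrete
Analysis 2021:22, 16 pp. (doi:10.19086/da.29067) = arXiv:1909.03180v2, whose numbering and pages
are used below (the journal is an arXiv overlay; v1 of 2019 numbers Lemmas 15/16 in the opposite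
order and has no separate Theorems 17–18), verbatim:

> (§1, p. 1) For a prime power `q`, let `𝔽_q` be the finite field of order `q`. Let `n > k ≥ 1` and
> `m ≥ 1` be integers. A subset `S ⊆ 𝔽_qⁿ` is a `(k, m)`-Furstenberg set if, for each rank `k`
> subspace `W` of `𝔽_qⁿ`, there is a translate of `W` that intersects `S` in at least `m` points. For
> a prime power `q` and integers `n, k,` and `m` with `1 ≤ k < n` and `m ≤ q^k`, let `K(q, n, k, m)`
> be the least `t` such that there exists a `(k, m)`-Furstenberg set in `𝔽_qⁿ` of cardinality `t`.
> A `(1, q)`-Furstenberg set is called a Kakeya set. […] For this case, the polynomial method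
> [DKSS] gives the bound `K(q, n, 1, q) ≥ 2^{−n} qⁿ`, (1) which is tight up to a factor of 2.
>
> (p. 2) **Theorem 1.** Let `q` be a prime power, and let `n, k,` and `m` be positive integers such
> that `m ≤ q^k`, then `K(q, n, k, m) ≥ (1/2ⁿ) m^{n/k}`.
> […] Let `S` be any set of `mq^{n−k}` points in `𝔽_qⁿ`. A simple pigeonholing argument shows that
> `S` is a `(k, m)`-Furstenberg set.
> (p. 3) **Theorem 4.** Let `q` be a prime power, and let `n, k` and `m` be positive integers such
> that `m ≤ q^k` and `n` is divisible by `k`, we have `K(q, n, k, m) ≥ (1/2^{n/k}) m^{n/k}`.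
>
> (§2.2, p. 5) **Lemma 12.** Given a non-negative integer `d` and a set of non-negative integers
> `N_x` indexed by elements `x ∈ 𝔽_qⁿ` which satisfy `∑_{x ∈ 𝔽_qⁿ} C(N_x + n − 1, n) < C(d + n, n)`,
> we can find a non-zero polynomial `P` of total degree at most `d` such that for all `x ∈ 𝔽_qⁿ`,
> `P` vanishes on `x` with multiplicity at least `N_x`.
>
> (§3, p. 6) Let `R` be a random variable (r.v.) taking values in `𝔽_qⁿ`. The `q`-ary min entropy
> of `R` […] is defined as `H^q_∞(R) = −log_q (max_{w ∈ 𝔽_qⁿ} Pr[R = w])`. For example, if `R` is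
> distributed uniformly on a set of size `q^k` then its min-entropy will be exactly `k`. In general,
> a r.v with min-entropy `k` must have support size at least `q^k`.
> **Definition 13.** (Furstenberg set bound, `A(n, k)`) Let `1 ≤ k < n` be integers. We say that
> the statement `A(n, k)` holds with constant `C_{n,k}` if the following is true: If `S ⊂ 𝔽_qⁿ` is
> `(k, m)`-Furstenberg then `|S| ≥ C_{n,k} · m^{n/k}`.
> **Definition 14.** (Linear maps with high min-entropy, `B(n, k)`) Let `1 ≤ k < n` be integers.
> We say that the statement `B(n, k)` holds with constant `D_{n,k}` if the following is true: For
> all `δ ∈ [0, 1]`, if `S ⊂ 𝔽_qⁿ` is of size `|S| = q^{δn}` then there exists an onto linear map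
> `φ : 𝔽_qⁿ → 𝔽_q^{n−k}` such that `H^q_∞(φ(U_S)) ≥ δ(n − k) − D_{n,k}`, where `U_S` is a random
> variable distributed uniformly over `S`, and `φ(U_S)` is the pushforward of `U_S`.
> **Lemma 15.** For integers `1 ≤ k < n`. If `B(n, k)` holds with constant `0 ≤ D_{n,k}`, then
> `A(n, k)` holds with constant `C_{n,k} = q^{−(n/k) D_{n,k}}`.
> (p. 7) **Lemma 16.** For integer `1 ≤ k < n`. If `A(n, k)` holds with constant `0 < C_{n,k} ≤ 1`
> then `B(n, k)` holds with constant `D_{n,k} = (k/n) · log_q(1/C_{n,k})`.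
>
> (p. 8) **Theorem 17** (Entropic-Furstenberg bound). For any random variable `R` supported over
> `𝔽_qⁿ` there exists an onto linear map `φ : 𝔽_qⁿ → 𝔽_q^{n−k}` such that
> `H^q_∞(φ(R)) ≥ ((n−k)/n) H^q_∞(R) − log_q(2 − q⁻¹) k`.
> Theorem 1 follows easily from Theorem 17. *Proof of Theorem 1.* Theorem 17 proves the statement
> `B(n, k)` with constant `D_{n,k} = k log_q(2)`. Lemma 15 then proves Theorem 1.
> **Theorem 18** (Entropic bound for `k = 1`). For any random variable `R` supported over `𝔽_qⁿ`
> there exists an onto linear map `φ : 𝔽_qⁿ → 𝔽_q^{n−1}` such that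
> `H^q_∞(φ(R)) ≥ ((n−1)/n) H^q_∞(R) − log_q(2 − q⁻¹)`.
> (§4, p. 8) **Theorem 19.** Given `r ∈ ℤ_{≥0}` and a function `f : 𝔽_qⁿ → ℤ` such that for every
> direction `γ` there exists a line `E_γ` in that direction such that `∑_{x ∈ E_γ} |f(x)| ≥ r` we have
> the following bound, `‖f‖ⁿ_{ℓⁿ} = ∑_{x ∈ 𝔽_qⁿ} |f(x)|ⁿ ≥ rⁿ/(2 − q⁻¹)ⁿ`.
> Note, if `f` is an indicator function for a subset of `𝔽_qⁿ` and `r = q` then the theorem above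
> is simply the Kakeya bound in [DKSS]. Also note that this theorem can easily be generalized to
> real valued functions and positive real `r` by taking ratios and limits.
> (p. 9) **Claim 20.** For all `b ∈ 𝔽_qⁿ`, `mult(P^H, b) ≥ m`.

## What is proved

* §2.2: `exists_mem_vanishesToOrder_of_sum_choose_lt`, **`exists_vanishesToOrder_of_sum_choose_lt`
  — Lemma 12** (the weighted form of DKSS Proposition 3.1); `sum_mult_line_le` (Lemmas 10–11 on a
  line: `∑_t mult(Q, a + tb) ≤ deg Q` unless `Q(a + tb) ≡ 0`).
* §3: `IsPMF`, `maxProb`, **`minEntropy`** (`H^q_∞`), `pushforward`, `uniformOn` (`U_S`) with their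
  API (`minEntropy_uniformOn`: uniform on `|S|` points has min-entropy `log_q |S|`;
  `rpow_minEntropy_le_card_support`: `q^{H_∞} ≤ |supp|`); **`IsFurstenberg k m S`** and
  **`furstenbergNumber K n k m` = `K(q, n, k, m)`**; `isFurstenberg_of_le_card` (the pigeonhole
  remark), `furstenbergNumber_le` (`K ≤ m q^{n−k}`); **`StatementA`, `StatementB` — Definitions 13,
  14**; **`statementA_of_statementB` — Lemma 15**; **`statementB_of_statementA` — Lemma 16**.
* §4: **`vanishesToOrder_homogeneousComponent_of_rich_lines` — Claim 20**; `choose_le_sum_choose`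
  — the finite-level inequality (14); `tendsto_choose_div_pow` (the limit);
  **`mul_card_pow_le_sum_abs_pow`, `div_pow_le_sum_abs_pow` — Theorem 19 for real-valued `f` and
  real `r ≥ 0`**, and **`div_pow_le_sum_abs_pow_int` — Theorem 19 as printed** (`f : 𝔽_qⁿ → ℤ`,
  `r ∈ ℤ_{≥ 0}`); `exists_linearMap_fiber_eq_line`, `pushforward_apply_eq_sum_line`;
  **`entropic_kakeya` — Theorem 18**.
* §5: **`entropic_furstenberg` — Theorem 17** (indexed by `n = m + k`; `entropic_furstenberg'` with
  `n` and `n − k`); `statementB_entropic` (`B(n, k)` with `D = k log_q(2 − q⁻¹)`) and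
  `statementB_entropic_two` (`D = k log_q 2`, as printed).
* §1: **`rpow_div_two_pow_le_card`, `rpow_div_two_pow_le_furstenbergNumber` — Theorem 1**
  (`m^{n/k}/2ⁿ ≤ |S|`, resp. `≤ K(q, n, k, m)`), and the constant the proof actually gives,
  `rpow_div_pow_le_card`, `rpow_div_pow_le_furstenbergNumber` (`m^{n/k}/(2 − q⁻¹)ⁿ`).
* §1: **`isFurstenberg_one_card_iff_isKakeya`** — "a `(1, q)`-Furstenberg set is called a Kakeya
  set": `IsFurstenberg 1 q S ↔ FiniteFieldKakeya.IsKakeya S` (Dvir's definition, `n ≥ 1`), and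
  `div_two_pow_le_furstenbergNumber_one` — eq. (1), `K(q, n, 1, q) ≥ (q/2)ⁿ`, from the DKSS file.
* §6: `div_pow_le_card_of_extension` (the transfer to `𝔽_{q^k}^r` for a given degree-`k`
  extension, `(m/(2 − q^{−k}))^r ≤ |S|`), `exists_extension_finrank_eq` (the extension exists, via
  `GaloisField`), **`rpow_div_two_rpow_le_card_of_dvd`, `rpow_div_two_rpow_le_furstenbergNumber_of_dvd`
  — Theorem 4** (`m^{n/k}/2^{n/k} ≤ |S|`, resp. `≤ K(q, n, k, m)`, for `k ∣ n`).

The proofs follow the printed ones; the method of multiplicities (Hasse derivatives, `mult`,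
DKSS Lemma 2.4, Corollary 2.6, Lemma 2.7, the Taylor coefficient on a line) is imported from
`KakeyaMethodOfMultiplicities.lean`.  Random variables are represented by their laws (real
probability mass functions on `𝔽_qⁿ = Fin n → K`), onto linear maps are `K`-linear maps
`(Fin n → K) →ₗ[K] (Fin (n − k) → K)`.

Deviations, declared.  (1) Theorem 19 is proved directly for real weights `|f|` and real `r ≥ 0`
(the paper proves the integer case and obtains the real case and Theorem 18 "by taking ratios and
limits" / "a simple limiting argument"): at level `k` the multiplicities are `N_x = ⌈(2q−1)k|f(x)|⌉`,
`m = ⌊kr⌋`, and one limit `k → ∞` replaces both printed limiting arguments; the integer statement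
is a corollary.  (2) The degree budget is `d = qm − 1` (as in DKSS Theorem 3.2 and
`KakeyaMethodOfMultiplicities.lean`); the journal text prints "Let `d = mq` where and
`N = m(2q − 1)/r`", with which its closing line "`mq ≤ d`, leading to a contradiction" does not
conclude — arXiv v1 has `d = mq − r`, which does; all three choices have the same limit.  (3) In
Claim 20 the direction `b = 0` is treated like every other direction (a point of mass `≥ r/q` on a
rich line plays the rôle of the line), instead of the printed "`P^H` is homogeneous of degree
`d > m`".  (4) Theorem 17 is proved with the spaces indexed as `𝔽_q^{m+k} → 𝔽_q^m` and the
induction composes the line map of Theorem 18 first and the inductive map second (the printed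
order is the reverse); the estimate is the printed substitution of (19) into (20).  (5) Lemmas 15
and 16 are proved without the sign conditions `D ≥ 0`, `C ≤ 1`, which their printed proofs do not
use.  (6) `IsFurstenberg` and the pigeonhole remark are stated for all `k, m` (the remark for
`|S| ≥ m q^{n−k}`); Theorem 1 carries the standing hypothesis `1 ≤ k < n` of §1 explicitly.

## Not in this file

* Theorems 2 and 3 and Lemmas 5, 6, 21–23 (§§2.1, 7: incidence bounds for large sets via
  eigenvalue methods — Haemers, Alon, Lund–Saraf); the closing remark of §6 (combining the
  recursion of Theorem 17 with Theorem 4 for better constants); Lemma 8 in general (DKSS Proposition 2.3 (4),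
  available as `FiniteFieldKakeya.hasseDeriv_hasseDeriv`); Lemma 11 for a general finite `U ⊆ 𝔽`
  (only `U = 𝔽_q`, DKSS Corollary 2.8, is used).
* The Ellenberg–Erman bound (5) and its streamlining [DDL-1]; the Kopparty–Lev–Saraf–Sudan bounds
  (3), (4).

## References

* [DharDvirLund2021FurstenbergFiniteFields] M. Dhar, Z. Dvir, B. Lund, Discrete Analysis 2021:22
  (arXiv:1909.03180v2) — §1 pp. 1–3 (definitions, Theorems 1–4), §2.2 p. 5 (Definitions 7, 9,
  Lemmas 8, 10–12), §3 pp. 6–8 (min-entropy, Definitions 13–14, Lemmas 15–16, Theorems 17–18),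
  §4 pp. 8–10 (Theorem 19, Claim 20, proof of Theorem 18), §5 p. 11 (proof of Theorem 17), §6
  p. 11 (proof of Theorem 4).
* [DvirEtAl2013] Z. Dvir, S. Kopparty, S. Saraf, M. Sudan, SIAM J. Comput. 42 (2013) — the
  extended method of multiplicities, as formalized in `KakeyaMethodOfMultiplicities.lean`.
-/

namespace Literature.Combinatorics.Kakeya

namespace Furstenberg

open MvPolynomial Finset
open FiniteFieldKakeya
open Literature.AlgebraicGeometry.Resolution (hasseDeriv)

variable {K : Type*} [Field K]

/-! ### §2.2: interpolation with prescribed multiplicities (Lemma 12); multiplicities on a line -/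
section Interpolation

variable {n : ℕ}

/-- **Lemma 12 (interpolation with prescribed multiplicities), in an arbitrary finite-dimensional
space `V` of polynomials:** if `∑_{a ∈ S} C(N_a + n − 1, n) < dim V` then some nonzero `g ∈ V`
vanishes at every `a ∈ S` with multiplicity at least `N_a` ("the condition of vanishing on `x`
with multiplicity `N_x` is defined by `C(N_x + n − 1, n)` many linear equations in the coefficients
of the polynomial", p. 6).  The uniform case `N_a = m` is
`FiniteFieldKakeya.exists_mem_vanishesToOrder` (DKSS Proposition 3.1).
[cite: DharDvirLund2021FurstenbergFiniteFields, Lemma 12 (§2.2, p. 5; proof p. 6)] -/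
theorem exists_mem_vanishesToOrder_of_sum_choose_lt (S : Finset (Fin n → K)) (N : (Fin n → K) → ℕ)
    (V : Submodule K (MvPolynomial (Fin n) K)) [Module.Finite K V]
    (hS : ∑ a ∈ S, (N a + n - 1).choose n < Module.finrank K V) :
    ∃ g ∈ V, g ≠ 0 ∧ ∀ a ∈ S, VanishesToOrder g a (N a) := by
  classical
  set S' := S.filter (fun a => 0 < N a) with hS'
  let B : (Fin n → K) → Finset (Option (Fin n) →₀ ℕ) := fun a =>
    (univ : Finset (Option (Fin n))).finsuppAntidiag (N a - 1)
  set T := S'.sigma B with hT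
  let Φ : V →ₗ[K] (↥T → K) :=
    LinearMap.pi fun p : ↥T =>
      (lcoeff K p.1.2.some).comp
        ((aeval (R := K) fun i => X i + C (p.1.1 i)).toLinearMap.comp V.subtype)
  have hBcard : ∀ a, 0 < N a → (B a).card = (N a + n - 1).choose n := by
    intro a ha
    show ((univ : Finset (Option (Fin n))).finsuppAntidiag (N a - 1)).card = _
    rw [card_finsuppAntidiag_nat_eq_choose, card_univ, Fintype.card_option, Fintype.card_fin,
      show n + 1 + (N a - 1) - 1 = (N a - 1) + n by omega, Nat.choose_symm_add,
      show N a - 1 + n = N a + n - 1 by omega]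
  have hTcard : T.card ≤ ∑ a ∈ S, (N a + n - 1).choose n := by
    rw [hT, Finset.card_sigma]
    calc ∑ a ∈ S', (B a).card = ∑ a ∈ S', (N a + n - 1).choose n :=
          sum_congr rfl fun a ha => hBcard a (mem_filter.1 ha).2
      _ ≤ ∑ a ∈ S, (N a + n - 1).choose n :=
          sum_le_sum_of_subset_of_nonneg (filter_subset _ _) fun _ _ _ => Nat.zero_le _
  have hlt : Module.finrank K (↥T → K) < Module.finrank K V := by
    rw [Module.finrank_fintype_fun_eq_card, Fintype.card_coe]
    exact lt_of_le_of_lt hTcard hS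
  obtain ⟨g, hgker, hg0⟩ :=
    (Submodule.ne_bot_iff _).1 (LinearMap.ker_ne_bot_of_finrank_lt (f := Φ) hlt)
  refine ⟨g.1, g.2, fun h => hg0 (Subtype.ext h), fun a ha s hs => ?_⟩
  by_contra hlt'
  have hNa : 0 < N a := by omega
  have ha' : a ∈ S' := mem_filter.2 ⟨ha, hNa⟩
  have hsd : s.degree ≤ N a - 1 := by omega
  let f : Option (Fin n) →₀ ℕ :=
    Finsupp.equivFunOnFinite.symm fun o => o.elim (N a - 1 - s.degree) s
  have hfs : f.some = s := by
    ext i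
    simp [f, Finsupp.some_apply]
  have hfB : f ∈ B a := by
    show f ∈ (univ : Finset (Option (Fin n))).finsuppAntidiag (N a - 1)
    rw [mem_finsuppAntidiag]
    refine ⟨?_, Finset.subset_univ _⟩
    rw [Fintype.sum_option]
    simp only [f, Finsupp.coe_equivFunOnFinite_symm, Option.elim]
    rw [← Finsupp.degree_eq_sum]
    omega
  have hmem : (⟨a, f⟩ : Σ _ : Fin n → K, Option (Fin n) →₀ ℕ) ∈ T :=
    Finset.mem_sigma.2 ⟨ha', hfB⟩
  have hΦ : Φ g = 0 := LinearMap.mem_ker.1 hgker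
  have hc := congr_fun hΦ ⟨⟨a, f⟩, hmem⟩
  simp only [Φ, LinearMap.pi_apply, LinearMap.comp_apply, Submodule.subtype_apply,
    AlgHom.toLinearMap_apply, lcoeff_apply, Pi.zero_apply, hfs] at hc
  exact (mem_support_iff.1 hs) hc

/-- **Lemma 12:** "Given a non-negative integer `d` and a set of non-negative integers `N_x`
indexed by elements `x ∈ 𝔽_qⁿ` which satisfy `∑_{x ∈ 𝔽_qⁿ} C(N_x + n − 1, n) < C(d + n, n)`, we can
find a non-zero polynomial `P` of total degree at most `d` such that for all `x ∈ 𝔽_qⁿ`, `P`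
vanishes on `x` with multiplicity at least `N_x`."
[cite: DharDvirLund2021FurstenbergFiniteFields, Lemma 12 (§2.2, p. 5)] -/
theorem exists_vanishesToOrder_of_sum_choose_lt [Fintype K] (N : (Fin n → K) → ℕ) (d : ℕ)
    (h : ∑ a : Fin n → K, (N a + n - 1).choose n < (d + n).choose n) :
    ∃ g : MvPolynomial (Fin n) K, g ≠ 0 ∧ g.totalDegree ≤ d ∧
      ∀ a, VanishesToOrder g a (N a) := by
  obtain ⟨g, hgV, hg0, hmult⟩ := exists_mem_vanishesToOrder_of_sum_choose_lt univ N
    (restrictTotalDegree (Fin n) K d) (h.trans_le (choose_le_finrank_restrictTotalDegree n d))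
  exact ⟨g, hg0, (mem_restrictTotalDegree _ _ _).1 hgV, fun a => hmult a (mem_univ a)⟩

end Interpolation

section Line

variable {n : ℕ}

/-- **Lemmas 10–11 on a line** (the step "(17): if `Q_{a,b}` is non-zero then Lemma 11 and (17)
give `∑_{t ∈ 𝔽_q} mult(Q_{a,b}, t) ≤ deg Q_{a,b}`", p. 9): if the restriction
`Q_{a,b}(t) = Q(a + tb)` is not identically zero then `∑_{t ∈ 𝔽_q} mult(Q, a + tb) ≤ deg Q` — by
`mult(Q_{a,b}, t) ≥ mult(Q, a + tb)` (Lemma 10, DKSS Corollary 2.6) and the univariate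
Schwartz–Zippel count (Lemma 11 with `n = 1`).
[cite: DharDvirLund2021FurstenbergFiniteFields, Lemmas 10–11 (§2.2, p. 5) and eq. (17) (p. 9)] -/
theorem sum_mult_line_le [Fintype K] [DecidableEq K] (a b : Fin n → K)
    (f : MvPolynomial (Fin n) K)
    (hL : aeval (fun i => Polynomial.C (a i) + Polynomial.C (b i) * Polynomial.X) f ≠ 0) :
    ∑ t : K, mult f (a + t • b) ≤ f.totalDegree :=
  calc ∑ t : K, mult f (a + t • b)
      ≤ ∑ t : K, Polynomial.rootMultiplicity t
          (aeval (fun i => Polynomial.C (a i) + Polynomial.C (b i) * Polynomial.X) f) :=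
        sum_le_sum fun t _ => mult_le_rootMultiplicity a b t f hL
    _ ≤ (aeval (fun i => Polynomial.C (a i) + Polynomial.C (b i) * Polynomial.X) f).natDegree :=
        sum_rootMultiplicity_le _
    _ ≤ f.totalDegree := Extremal.natDegree_aeval_line_le a b f

end Line

/-! ### §3: min-entropy, random variables as laws, pushforwards -/
section MinEntropy

variable {α β γ : Type*} [Fintype α] [Fintype β] [Fintype γ] [DecidableEq β] [DecidableEq γ]

/-- The law of "a random variable `R` taking values in" a finite set (§3, p. 6): a probability mass
function — nonnegative weights summing to `1`. [cite: DharDvirLund2021FurstenbergFiniteFields, §3 (p. 6)] -/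
def IsPMF (p : α → ℝ) : Prop :=
  (∀ x, 0 ≤ p x) ∧ ∑ x, p x = 1

/-- `max_w Pr[R = w]`, the largest point mass (the probability of the mode).
[cite: DharDvirLund2021FurstenbergFiniteFields, §3 (p. 6, definition of min-entropy)] -/
noncomputable def maxProb [Nonempty α] (p : α → ℝ) : ℝ :=
  (univ : Finset α).sup' univ_nonempty p

/-- **The `q`-ary min-entropy** `H^q_∞(R) = −log_q (max_{w} Pr[R = w])` ("For example, if `R` is
distributed uniformly on a set of size `q^k` then its min-entropy will be exactly `k`. In general, a
r.v with min-entropy `k` must have support size at least `q^k`": `minEntropy_uniformOn`,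
`rpow_minEntropy_le_card_support`). [cite: DharDvirLund2021FurstenbergFiniteFields, §3 (p. 6)] -/
noncomputable def minEntropy [Nonempty α] (q : ℕ) (p : α → ℝ) : ℝ :=
  -Real.logb q (maxProb p)

/-- The law of `φ(R)` ("`φ(U_S)` is the pushforward of `U_S`", Definition 14):
`Pr[φ(R) = y] = ∑_{x : φ(x) = y} Pr[R = x]`. [cite: DharDvirLund2021FurstenbergFiniteFields, Definition 14 (§3, p. 6)] -/
noncomputable def pushforward (φ : α → β) (p : α → ℝ) : β → ℝ :=
  fun y => ∑ x ∈ univ.filter (fun x => φ x = y), p x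

omit [Fintype β] in
/-- Unfolding lemma for `pushforward` ("the pushforward of `U_S`").
[cite: DharDvirLund2021FurstenbergFiniteFields, Definition 14 (§3, p. 6)] -/
theorem pushforward_apply (φ : α → β) (p : α → ℝ) (y : β) :
    pushforward φ p y = ∑ x ∈ univ.filter (fun x => φ x = y), p x :=
  rfl

/-- Every point mass is at most the largest one, `Pr[R = x] ≤ max_w Pr[R = w]`.
[cite: DharDvirLund2021FurstenbergFiniteFields, §3 (p. 6)] -/
theorem le_maxProb [Nonempty α] (p : α → ℝ) (x : α) : p x ≤ maxProb p :=
  Finset.le_sup' p (mem_univ x)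

/-- The largest point mass is attained: "`v ∈ 𝔽_qⁿ` is the mode of `R`" (p. 10).
[cite: DharDvirLund2021FurstenbergFiniteFields, §3 (p. 6) and proof of Theorem 18 (p. 10)] -/
theorem exists_eq_maxProb [Nonempty α] (p : α → ℝ) : ∃ x, p x = maxProb p := by
  obtain ⟨x, _, hx⟩ := exists_mem_eq_sup' (univ_nonempty (α := α)) p
  exact ⟨x, hx.symm⟩

/-- A uniform bound on the point masses bounds the largest one. [cite: DharDvirLund2021FurstenbergFiniteFields, §3 (p. 6)] -/
theorem maxProb_le [Nonempty α] {p : α → ℝ} {c : ℝ} (h : ∀ x, p x ≤ c) : maxProb p ≤ c :=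
  Finset.sup'_le _ _ fun x _ => h x

/-- A probability mass function has a point of positive mass (so `H^q_∞` is finite).
[cite: DharDvirLund2021FurstenbergFiniteFields, §3 (p. 6)] -/
theorem IsPMF.maxProb_pos [Nonempty α] {p : α → ℝ} (hp : IsPMF p) : 0 < maxProb p := by
  by_contra h
  push Not at h
  have : ∑ x, p x ≤ 0 := Finset.sum_nonpos fun x _ => (le_maxProb p x).trans h
  linarith [hp.2]

/-- Point masses are at most `1` (so `H^q_∞ ≥ 0`). [cite: DharDvirLund2021FurstenbergFiniteFields, §3 (p. 6)] -/
theorem IsPMF.maxProb_le_one [Nonempty α] {p : α → ℝ} (hp : IsPMF p) : maxProb p ≤ 1 := by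
  obtain ⟨x, hx⟩ := exists_eq_maxProb p
  rw [← hx, ← hp.2]
  exact Finset.single_le_sum (fun y _ => hp.1 y) (mem_univ x)

/-- Min-entropy is nonnegative (for `q > 1`). [cite: DharDvirLund2021FurstenbergFiniteFields, §3 (p. 6)] -/
theorem IsPMF.minEntropy_nonneg [Nonempty α] {q : ℕ} (hq : 1 < q) {p : α → ℝ} (hp : IsPMF p) :
    0 ≤ minEntropy q p := by
  rw [minEntropy, neg_nonneg]
  exact Real.logb_nonpos (by exact_mod_cast hq) hp.maxProb_pos.le hp.maxProb_le_one

/-- The pushforward of a probability mass function is one (the law of `φ(R)`).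
[cite: DharDvirLund2021FurstenbergFiniteFields, Definition 14 (§3, p. 6)] -/
theorem IsPMF.pushforward {p : α → ℝ} (hp : IsPMF p) (φ : α → β) : IsPMF (pushforward φ p) := by
  refine ⟨fun y => Finset.sum_nonneg fun x _ => hp.1 x, ?_⟩
  simp only [pushforward_apply]
  rw [Finset.sum_fiberwise univ φ p]
  exact hp.2

omit [Fintype γ] in
/-- Pushforwards compose: `(ψ ∘ φ)(R) = ψ(φ(R))` (the induction of Theorem 17, "composing a
sequence of onto maps"). [cite: DharDvirLund2021FurstenbergFiniteFields, proof of Theorem 17 (§5, p. 11)] -/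
theorem pushforward_comp (φ : α → β) (ψ : β → γ) (p : α → ℝ) :
    pushforward (ψ ∘ φ) p = pushforward ψ (pushforward φ p) := by
  funext z
  simp only [pushforward_apply, Function.comp_apply]
  rw [← Finset.sum_fiberwise_of_maps_to (g := φ) (t := univ.filter fun y => ψ y = z)]
  · refine Finset.sum_congr rfl fun y hy => Finset.sum_congr ?_ fun _ _ => rfl
    ext x
    simp only [mem_filter, mem_univ, true_and]
    constructor
    · rintro ⟨h1, h2⟩
      exact h2
    · intro h
      rw [mem_filter] at hy
      exact ⟨by rw [h]; exact hy.2, h⟩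
  · intro x hx
    rw [mem_filter] at hx ⊢
    exact ⟨mem_univ _, hx.2⟩

/-- "In general, a r.v with min-entropy `k` must have support size at least `q^k`":
`q^{H_∞(R)} ≤ |supp R|` (indeed `q^{H_∞} = 1/max Pr` and `1 = ∑ Pr ≤ |supp| · max Pr`).
[cite: DharDvirLund2021FurstenbergFiniteFields, §3 (p. 6)] -/
theorem rpow_minEntropy_le_card_support [Nonempty α] [DecidableEq α] {q : ℕ} (hq : 1 < q)
    {p : α → ℝ} (hp : IsPMF p) :
    (q : ℝ) ^ minEntropy q p ≤ (univ.filter fun x => p x ≠ 0).card := by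
  have hqR : (1 : ℝ) < q := by exact_mod_cast hq
  have hM := hp.maxProb_pos
  rw [minEntropy, Real.rpow_neg (by positivity), Real.rpow_logb (by positivity) hqR.ne' hM]
  rw [inv_le_iff_one_le_mul₀ hM]
  calc (1 : ℝ) = ∑ x, p x := hp.2.symm
    _ = ∑ x ∈ univ.filter (fun x => p x ≠ 0), p x := by
        rw [Finset.sum_filter_ne_zero]
    _ ≤ ∑ x ∈ univ.filter (fun x => p x ≠ 0), maxProb p :=
        Finset.sum_le_sum fun x _ => le_maxProb p x
    _ = (univ.filter fun x => p x ≠ 0).card * maxProb p := by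
        rw [Finset.sum_const, nsmul_eq_mul]

/-- The law of `U_S`, "a random variable distributed uniformly over `S`" (Definition 14): mass
`1/|S|` on `S`, `0` elsewhere. [cite: DharDvirLund2021FurstenbergFiniteFields, Definition 14 (§3, p. 6)] -/
noncomputable def uniformOn [DecidableEq α] (S : Finset α) : α → ℝ :=
  fun x => if x ∈ S then 1 / S.card else 0

/-- `U_S` is a probability mass function for `S` nonempty. [cite: DharDvirLund2021FurstenbergFiniteFields, Definition 14 (§3, p. 6)] -/
theorem isPMF_uniformOn [DecidableEq α] {S : Finset α} (hS : S.Nonempty) : IsPMF (uniformOn S) := by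
  refine ⟨fun x => by unfold uniformOn; split_ifs <;> positivity, ?_⟩
  simp only [uniformOn]
  rw [Finset.sum_ite_mem, univ_inter, Finset.sum_const, nsmul_eq_mul,
    mul_one_div_cancel (by exact_mod_cast hS.card_pos.ne')]

/-- The largest point mass of `U_S` is `1/|S|`. [cite: DharDvirLund2021FurstenbergFiniteFields, Definition 14 (§3, p. 6)] -/
theorem maxProb_uniformOn [Nonempty α] [DecidableEq α] {S : Finset α} (hS : S.Nonempty) :
    maxProb (uniformOn S) = 1 / S.card := by
  apply le_antisymm
  · refine maxProb_le fun x => ?_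
    unfold uniformOn
    split_ifs
    · exact le_rfl
    · positivity
  · obtain ⟨x, hx⟩ := hS
    have := le_maxProb (uniformOn S) x
    rwa [uniformOn, if_pos hx] at this

/-- "if `R` is distributed uniformly on a set of size `q^k` then its min-entropy will be exactly
`k`": `H^q_∞(U_S) = log_q |S|`. [cite: DharDvirLund2021FurstenbergFiniteFields, §3 (p. 6)] -/
theorem minEntropy_uniformOn [Nonempty α] [DecidableEq α] (q : ℕ) {S : Finset α} (hS : S.Nonempty) :
    minEntropy q (uniformOn S) = Real.logb q S.card := by
  rw [minEntropy, maxProb_uniformOn hS, one_div, Real.logb_inv, neg_neg]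

omit [Fintype β] in
/-- `Pr[φ(U_S) = y] = |φ⁻¹(y) ∩ S| / |S|` (eq. (11) of the proof of Lemma 16). [cite: DharDvirLund2021FurstenbergFiniteFields, Lemma 16 (proof, eq. (11), p. 7)] -/
theorem pushforward_uniformOn [DecidableEq α] (φ : α → β) {S : Finset α} (y : β) :
    pushforward φ (uniformOn S) y = (S.filter fun x => φ x = y).card / S.card := by
  rw [pushforward_apply]
  simp only [uniformOn]
  rw [Finset.sum_ite, Finset.sum_const_zero, add_zero, Finset.sum_const, nsmul_eq_mul,
    mul_one_div]
  congr 2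
  · congr 1
    ext x
    simp [and_comm]

end MinEntropy

/-! ### §1, §3: Furstenberg sets, `K(q, n, k, m)`, the statements `A(n, k)`, `B(n, k)` and Lemmas 15–16 -/
section FurstenbergSets

variable {n : ℕ}

/-- **`(k, m)`-Furstenberg sets** (§1, p. 1): "A subset `S ⊆ 𝔽_qⁿ` is a `(k, m)`-Furstenberg set
if, for each rank `k` subspace `W` of `𝔽_qⁿ`, there is a translate of `W` that intersects `S` in
at least `m` points."  The translate `W + x` is `{y | y − x ∈ W}`. [cite: DharDvirLund2021FurstenbergFiniteFields, §1 (p. 1)] -/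
def IsFurstenberg (k m : ℕ) (S : Set (Fin n → K)) : Prop :=
  ∀ W : Submodule K (Fin n → K), Module.finrank K W = k →
    ∃ x : Fin n → K, m ≤ {y ∈ S | y - x ∈ W}.ncard

/-- Unfolding lemma for `IsFurstenberg`. [cite: DharDvirLund2021FurstenbergFiniteFields, §1 (p. 1)] -/
theorem isFurstenberg_iff (k m : ℕ) (S : Set (Fin n → K)) :
    IsFurstenberg k m S ↔ ∀ W : Submodule K (Fin n → K), Module.finrank K W = k →
      ∃ x : Fin n → K, m ≤ {y ∈ S | y - x ∈ W}.ncard :=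
  Iff.rfl

/-- A finite superset of a `(k, m)`-Furstenberg set is `(k, m)`-Furstenberg.
[cite: DharDvirLund2021FurstenbergFiniteFields, §1 (p. 1)] -/
theorem IsFurstenberg.mono {k m : ℕ} {S T : Set (Fin n → K)} (hS : IsFurstenberg k m S)
    (hST : S ⊆ T) (hT : T.Finite) : IsFurstenberg k m T := by
  intro W hW
  obtain ⟨x, hx⟩ := hS W hW
  exact ⟨x, hx.trans (Set.ncard_le_ncard (fun y hy => ⟨hST hy.1, hy.2⟩) (hT.subset fun y hy => hy.1))⟩

/-- `(k, m)`-Furstenberg implies `(k, m')`-Furstenberg for `m' ≤ m`. [cite: DharDvirLund2021FurstenbergFiniteFields, §1 (p. 1)] -/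
theorem IsFurstenberg.of_le {k m m' : ℕ} {S : Set (Fin n → K)} (hS : IsFurstenberg k m S)
    (h : m' ≤ m) : IsFurstenberg k m' S :=
  fun W hW => (hS W hW).imp fun _ hx => h.trans hx

/-- `𝔽ⁿ` has a subspace of every rank `k ≤ n` (the span of `k` coordinate vectors), so the
`(k, m)`-Furstenberg condition is not vacuous for `k ≤ n`. [cite: DharDvirLund2021FurstenbergFiniteFields, §1 (p. 1)] -/
theorem exists_submodule_finrank_eq {k : ℕ} (hkn : k ≤ n) :
    ∃ W : Submodule K (Fin n → K), Module.finrank K W = k := by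
  let v : Fin k → (Fin n → K) := fun i => Pi.basisFun K (Fin n) (Fin.castLE hkn i)
  have hv : LinearIndependent K v :=
    (Pi.basisFun K (Fin n)).linearIndependent.comp _ (Fin.castLE_injective hkn)
  exact ⟨Submodule.span K (Set.range v), by rw [finrank_span_eq_card hv, Fintype.card_fin]⟩

/-- A `(k, m)`-Furstenberg set with `m ≥ 1`, `k ≤ n` is nonempty. [cite: DharDvirLund2021FurstenbergFiniteFields, §1 (p. 1)] -/
theorem IsFurstenberg.nonempty {k m : ℕ} {S : Set (Fin n → K)} (hS : IsFurstenberg k m S)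
    (hm : 1 ≤ m) (hkn : k ≤ n) : S.Nonempty := by
  obtain ⟨W, hW⟩ := exists_submodule_finrank_eq (K := K) hkn
  obtain ⟨x, hx⟩ := hS W hW
  have hne : {y ∈ S | y - x ∈ W}.Nonempty :=
    Set.nonempty_of_ncard_ne_zero (by omega)
  obtain ⟨y, hy⟩ := hne
  exact ⟨y, hy.1⟩

/-- The points of a finset satisfying a predicate, counted as a set. [folklore] -/
private theorem ncard_sep_coe {α : Type*} (S : Finset α) (P : α → Prop) [DecidablePred P] :
    {y ∈ (S : Set α) | P y}.ncard = (S.filter P).card := by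
  rw [← Set.ncard_coe_finset (S.filter P)]
  congr 1
  ext y
  simp

variable [Fintype K] [DecidableEq K]

omit [DecidableEq K] in
/-- "Let `S` be any set of `m q^{n−k}` points in `𝔽_qⁿ`. A simple pigeonholing argument shows that
`S` is a `(k, m)`-Furstenberg set" (§1, p. 2): the `q^{n−k}` translates of a rank-`k` subspace `W`
partition `𝔽_qⁿ`, so one of them carries at least `|S|/q^{n−k} ≥ m` points of `S`.  (Stated for
`|S| ≥ m q^{n−k}`.) [cite: DharDvirLund2021FurstenbergFiniteFields, §1 (p. 2)] -/
theorem isFurstenberg_of_le_card {k m : ℕ} (S : Finset (Fin n → K))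
    (h : m * Fintype.card K ^ (n - k) ≤ S.card) : IsFurstenberg k m (S : Set (Fin n → K)) := by
  classical
  intro W hW
  haveI : Finite ((Fin n → K) ⧸ W) := Module.finite_of_finite K
  letI : Fintype ((Fin n → K) ⧸ W) := Fintype.ofFinite _
  have hcard : Fintype.card ((Fin n → K) ⧸ W) = Fintype.card K ^ (n - k) := by
    rw [Module.card_eq_pow_finrank (K := K) (V := (Fin n → K) ⧸ W)]
    congr 1
    have h := W.finrank_quotient_add_finrank
    rw [hW, Module.finrank_fintype_fun_eq_card, Fintype.card_fin] at h
    omega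
  obtain ⟨y, _, hy⟩ := Finset.exists_le_card_fiber_of_mul_le_card_of_maps_to
    (f := W.mkQ) (s := S) (t := univ) (fun a _ => mem_univ _) univ_nonempty
    (by rw [card_univ, hcard, mul_comm]; exact h)
  obtain ⟨x, rfl⟩ := W.mkQ_surjective y
  refine ⟨x, ?_⟩
  rw [ncard_sep_coe]
  convert hy using 2
  ext z
  simp only [Submodule.mkQ_apply, Submodule.Quotient.eq]

/-- **`K(q, n, k, m)`** (§1, p. 1): "let `K(q, n, k, m)` be the least `t` such that there exists a
`(k, m)`-Furstenberg set in `𝔽_qⁿ` of cardinality `t`" (as an infimum over `ℕ`; it is attained when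
`m ≤ q^k` and `k ≤ n`, `exists_card_eq_furstenbergNumber`). [cite: DharDvirLund2021FurstenbergFiniteFields, §1 (p. 1)] -/
noncomputable def furstenbergNumber (K : Type*) [Field K] (n k m : ℕ) : ℕ :=
  sInf {t : ℕ | ∃ S : Finset (Fin n → K), S.card = t ∧ IsFurstenberg k m (S : Set (Fin n → K))}

omit [DecidableEq K] in
/-- `𝔽_qⁿ` itself is `(k, m)`-Furstenberg for `m ≤ q^k`, `k ≤ n` (so `K(q, n, k, m)` is defined
exactly in the printed range "`1 ≤ k < n` and `m ≤ q^k`"). [cite: DharDvirLund2021FurstenbergFiniteFields, §1 (p. 1)] -/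
theorem isFurstenberg_univ {k m : ℕ} (hkn : k ≤ n) (hm : m ≤ Fintype.card K ^ k) :
    IsFurstenberg k m ((univ : Finset (Fin n → K)) : Set (Fin n → K)) := by
  refine isFurstenberg_of_le_card _ ?_
  rw [card_univ, Fintype.card_fun, Fintype.card_fin]
  calc m * Fintype.card K ^ (n - k) ≤ Fintype.card K ^ k * Fintype.card K ^ (n - k) :=
      Nat.mul_le_mul_right _ hm
    _ = Fintype.card K ^ n := by rw [← pow_add, Nat.add_sub_cancel' hkn]

omit [Fintype K] [DecidableEq K] in
/-- `K(q, n, k, m) ≤ |S|` for every `(k, m)`-Furstenberg `S` ("the least `t` such that …").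
[cite: DharDvirLund2021FurstenbergFiniteFields, §1 (p. 1)] -/
theorem furstenbergNumber_le_card {k m : ℕ} (S : Finset (Fin n → K))
    (hS : IsFurstenberg k m (S : Set (Fin n → K))) : furstenbergNumber K n k m ≤ S.card :=
  Nat.sInf_le ⟨S, rfl, hS⟩

omit [DecidableEq K] in
/-- `K(q, n, k, m)` is attained by some `(k, m)`-Furstenberg set (for `m ≤ q^k`, `k ≤ n`).
[cite: DharDvirLund2021FurstenbergFiniteFields, §1 (p. 1)] -/
theorem exists_card_eq_furstenbergNumber {k m : ℕ} (hkn : k ≤ n) (hm : m ≤ Fintype.card K ^ k) :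
    ∃ S : Finset (Fin n → K), S.card = furstenbergNumber K n k m ∧
      IsFurstenberg k m (S : Set (Fin n → K)) :=
  Nat.sInf_mem (⟨_, univ, rfl, isFurstenberg_univ hkn hm⟩ :
    {t : ℕ | ∃ S : Finset (Fin n → K), S.card = t ∧
      IsFurstenberg k m (S : Set (Fin n → K))}.Nonempty)

omit [DecidableEq K] in
/-- The trivial construction: `K(q, n, k, m) ≤ m q^{n−k}` ("there are no Furstenberg sets much
smaller than this trivial construction" is the content of Theorem 2). [cite: DharDvirLund2021FurstenbergFiniteFields, §1 (p. 2)] -/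
theorem furstenbergNumber_le {k m : ℕ} (hkn : k ≤ n) (hm : m ≤ Fintype.card K ^ k) :
    furstenbergNumber K n k m ≤ m * Fintype.card K ^ (n - k) := by
  have hle : m * Fintype.card K ^ (n - k) ≤ (univ : Finset (Fin n → K)).card := by
    rw [card_univ, Fintype.card_fun, Fintype.card_fin]
    calc m * Fintype.card K ^ (n - k) ≤ Fintype.card K ^ k * Fintype.card K ^ (n - k) :=
        Nat.mul_le_mul_right _ hm
      _ = Fintype.card K ^ n := by rw [← pow_add, Nat.add_sub_cancel' hkn]
  obtain ⟨S, _, hS⟩ := Finset.exists_subset_card_eq hle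
  rw [← hS]
  exact furstenbergNumber_le_card S (isFurstenberg_of_le_card S hS.ge)

omit [Fintype K] [DecidableEq K] in
/-- "Since `K_φ` can be any `k`-dimensional linear subspace" (proof of Lemma 16): every subspace
`W ≤ 𝔽_qⁿ` is the kernel of an onto linear map to any space of the complementary dimension (the
quotient map followed by a linear isomorphism). [cite: DharDvirLund2021FurstenbergFiniteFields, Lemma 16 (proof, p. 7)] -/
theorem exists_linearMap_ker_eq {V₂ : Type*} [AddCommGroup V₂] [Module K V₂]
    [FiniteDimensional K V₂] (W : Submodule K (Fin n → K))
    (hW : Module.finrank K W + Module.finrank K V₂ = n) :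
    ∃ φ : (Fin n → K) →ₗ[K] V₂, Function.Surjective φ ∧ LinearMap.ker φ = W := by
  have hQ : Module.finrank K ((Fin n → K) ⧸ W) = Module.finrank K V₂ := by
    have h := W.finrank_quotient_add_finrank
    rw [Module.finrank_fintype_fun_eq_card, Fintype.card_fin] at h
    omega
  let e : ((Fin n → K) ⧸ W) ≃ₗ[K] V₂ := LinearEquiv.ofFinrankEq _ _ hQ
  refine ⟨e.toLinearMap ∘ₗ W.mkQ, e.surjective.comp W.mkQ_surjective, ?_⟩
  rw [LinearMap.ker_comp, LinearEquiv.ker, Submodule.comap_bot, Submodule.ker_mkQ]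

omit [Fintype K] [DecidableEq K] in
/-- "`φ⁻¹(x)` is a `k`-flat for each `x ∈ 𝔽^{n−k}`" (proof of Lemma 15): the kernel of an onto linear
map `𝔽_qⁿ → V₂` has rank `n − dim V₂` (rank–nullity). [cite: DharDvirLund2021FurstenbergFiniteFields, Lemma 15 (proof, p. 7)] -/
theorem finrank_ker_of_surjective {V₂ : Type*} [AddCommGroup V₂] [Module K V₂]
    [FiniteDimensional K V₂] {φ : (Fin n → K) →ₗ[K] V₂} (hφ : Function.Surjective φ) :
    Module.finrank K (LinearMap.ker φ) + Module.finrank K V₂ = n := by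
  have h := φ.finrank_range_add_finrank_ker
  rw [LinearMap.range_eq_top.2 hφ, finrank_top, Module.finrank_fintype_fun_eq_card,
    Fintype.card_fin] at h
  omega

/-- "Since `φ⁻¹(x)` is a `k`-flat for each `x ∈ 𝔽^{n−k}` and `S` is `(k, m)`-Furstenberg,
`max_{x} |φ⁻¹(x)| ≥ m`; and hence `H^q_∞(φ(U_S)) ≤ −log_q(m |S|⁻¹)`" (proof of Lemma 15): the
largest point mass of `φ(U_S)` is at least `m/|S|`, for every onto `φ` to a space of dimension
`n − k`. [cite: DharDvirLund2021FurstenbergFiniteFields, Lemma 15 (proof, p. 7)] -/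
theorem div_le_maxProb_pushforward {V₂ : Type*} [AddCommGroup V₂] [Module K V₂]
    [FiniteDimensional K V₂] [Fintype V₂] [DecidableEq V₂] {k m : ℕ} {S : Finset (Fin n → K)}
    (hS : IsFurstenberg k m (S : Set (Fin n → K)))
    {φ : (Fin n → K) →ₗ[K] V₂} (hφ : Function.Surjective φ)
    (hk : Module.finrank K V₂ + k = n) :
    (m : ℝ) / S.card ≤ maxProb (pushforward φ (uniformOn S)) := by
  classical
  have hker : Module.finrank K (LinearMap.ker φ) = k := by
    have := finrank_ker_of_surjective hφ
    omega
  obtain ⟨x, hx⟩ := hS (LinearMap.ker φ) hker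
  have hset : {y ∈ (S : Set (Fin n → K)) | y - x ∈ LinearMap.ker φ}.ncard =
      (S.filter fun y => φ y = φ x).card := by
    rw [ncard_sep_coe]
    congr 1
    ext y
    simp only [mem_filter, LinearMap.mem_ker, map_sub, sub_eq_zero]
  rw [hset] at hx
  refine le_trans ?_ (le_maxProb _ (φ x))
  rw [pushforward_uniformOn]
  exact div_le_div_of_nonneg_right (by exact_mod_cast hx) (by positivity)

/-- **Definition 13 (Furstenberg set bound, `A(n, k)`):** "We say that the statement `A(n, k)` holds
with constant `C_{n,k}` if the following is true: If `S ⊂ 𝔽_qⁿ` is `(k, m)`-Furstenberg then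
`|S| ≥ C_{n,k} · m^{n/k}`."  (For the fixed field `K = 𝔽_q`; the exponent `n/k` is real.)
[cite: DharDvirLund2021FurstenbergFiniteFields, Definition 13 (§3, p. 6)] -/
def StatementA (K : Type*) [Field K] (n k : ℕ) (C : ℝ) : Prop :=
  ∀ (m : ℕ) (S : Finset (Fin n → K)), IsFurstenberg k m (S : Set (Fin n → K)) →
    C * (m : ℝ) ^ ((n : ℝ) / k) ≤ S.card

/-- **Definition 14 (Linear maps with high min-entropy, `B(n, k)`):** "We say that the statement
`B(n, k)` holds with constant `D_{n,k}` if the following is true: For all `δ ∈ [0, 1]`, if `S ⊂ 𝔽_qⁿ` is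
of size `|S| = q^{δn}` then there exists an onto linear map `φ : 𝔽_qⁿ → 𝔽_q^{n−k}` such that
`H^q_∞(φ(U_S)) ≥ δ(n − k) − D_{n,k}`, where `U_S` is a random variable distributed uniformly over `S`,
and `φ(U_S)` is the pushforward of `U_S`."  For nonempty `S` the parameter is `δ = log_q |S| / n`.
[cite: DharDvirLund2021FurstenbergFiniteFields, Definition 14 (§3, p. 6)] -/
def StatementB (K : Type*) [Field K] [Fintype K] [DecidableEq K] (n k : ℕ) (D : ℝ) : Prop :=
  ∀ S : Finset (Fin n → K), S.Nonempty →
    ∃ φ : (Fin n → K) →ₗ[K] (Fin (n - k) → K), Function.Surjective φ ∧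
      Real.logb (Fintype.card K) S.card / n * (n - k) - D ≤
        minEntropy (Fintype.card K) (pushforward φ (uniformOn S))

/-- `B(n, k)` with constant `D` implies `B(n, k)` with any larger constant.
[cite: DharDvirLund2021FurstenbergFiniteFields, Definition 14 (§3, p. 6)] -/
theorem StatementB.mono {k : ℕ} {D D' : ℝ} (h : StatementB K n k D) (hDD' : D ≤ D') :
    StatementB K n k D' := by
  intro S hS
  obtain ⟨φ, hφs, hφ⟩ := h S hS
  exact ⟨φ, hφs, by linarith⟩

/-- **Lemma 15:** "For integers `1 ≤ k < n`. If `B(n, k)` holds with constant `0 ≤ D_{n,k}`, then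
`A(n, k)` holds with constant `C_{n,k} = q^{−(n/k) D_{n,k}}`."  Proof as printed (p. 7): for `S`
Furstenberg and the map `φ` of `B(n, k)`, `max_x |φ⁻¹(x) ∩ S| ≥ m` gives
`H^q_∞(φ(U_S)) ≤ log_q(|S|/m)`, and with `|S| = q^{δn}`, `B(n, k)` gives
`log_q(m|S|⁻¹) ≤ D − δ(n − k)`, i.e. `m ≤ q^D |S|^{k/n}`.  (The hypothesis `D ≥ 0` is not used.)
[cite: DharDvirLund2021FurstenbergFiniteFields, Lemma 15 (§3, p. 6; proof p. 7)] -/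
theorem statementA_of_statementB {k : ℕ} (hk : 1 ≤ k) (hkn : k < n) {D : ℝ}
    (hB : StatementB K n k D) :
    StatementA K n k ((Fintype.card K : ℝ) ^ (-((n : ℝ) / k) * D)) := by
  classical
  intro m S hS
  set q := Fintype.card K with hq
  have hq2 : 1 < q := Fintype.one_lt_card
  have hqR : (1 : ℝ) < q := by exact_mod_cast hq2
  have hnk : (0 : ℝ) < (n : ℝ) / k := by
    have : (0 : ℝ) < k := by exact_mod_cast hk
    have : (0 : ℝ) < n := by exact_mod_cast (by omega : 0 < n)
    positivity
  rcases Nat.eq_zero_or_pos m with rfl | hm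
  · rw [Nat.cast_zero, Real.zero_rpow hnk.ne', mul_zero]
    positivity
  have hSne : S.Nonempty := by
    have := hS.nonempty hm hkn.le
    exact_mod_cast this
  have hScard : (0 : ℝ) < S.card := by exact_mod_cast hSne.card_pos
  have hmR : (0 : ℝ) < m := by exact_mod_cast hm
  obtain ⟨φ, hφs, hφ⟩ := hB S hSne
  -- the largest fibre has mass ≥ m / |S|
  have hmax : (m : ℝ) / S.card ≤ maxProb (pushforward φ (uniformOn S)) :=
    div_le_maxProb_pushforward hS hφs (by
      rw [Module.finrank_fintype_fun_eq_card, Fintype.card_fin]; omega)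
  have h1 : minEntropy q (pushforward φ (uniformOn S)) ≤ Real.logb q S.card - Real.logb q m := by
    rw [minEntropy, ← Real.logb_div hScard.ne' hmR.ne', neg_le]
    have : Real.logb q (m / S.card) ≤ Real.logb q (maxProb (pushforward φ (uniformOn S))) :=
      Real.logb_le_logb_of_le hqR (by positivity) hmax
    rw [Real.logb_div hmR.ne' hScard.ne'] at this
    rw [Real.logb_div hScard.ne' hmR.ne']
    linarith
  -- combine: (n/k) log m ≤ log |S| + (n/k) D
  have h2 : (n : ℝ) / k * Real.logb q m ≤ Real.logb q S.card + (n : ℝ) / k * D := by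
    have h3 := hφ.trans h1
    have hkR : (0 : ℝ) < k := by exact_mod_cast hk
    have hnR : (0 : ℝ) < n := by exact_mod_cast (by omega : 0 < n)
    rw [div_mul_eq_mul_div, le_sub_iff_add_le] at h3
    -- h3 : logb |S| * (n - k) / n - D + logb m ≤ logb |S|
    have h4 : Real.logb q m ≤ Real.logb q S.card * k / n + D := by
      have : Real.logb q S.card * (n - k) / n =
          Real.logb q S.card - Real.logb q S.card * k / n := by
        field_simp
      linarith
    have h5 : (n : ℝ) / k * (Real.logb q S.card * k / n) = Real.logb q S.card := by
      field_simp
    calc (n : ℝ) / k * Real.logb q m ≤ (n : ℝ) / k * (Real.logb q S.card * k / n + D) :=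
          mul_le_mul_of_nonneg_left h4 hnk.le
      _ = Real.logb q S.card + (n : ℝ) / k * D := by rw [mul_add, h5]
  -- exponentiate
  have h6 : (m : ℝ) ^ ((n : ℝ) / k) ≤ S.card * (q : ℝ) ^ ((n : ℝ) / k * D) := by
    rw [← Real.logb_le_logb hqR (by positivity) (by positivity),
      Real.logb_rpow_eq_mul_logb_of_pos hmR, Real.logb_mul hScard.ne' (by positivity),
      Real.logb_rpow (by positivity) hqR.ne']
    exact h2
  rw [neg_mul, Real.rpow_neg (by positivity), inv_mul_le_iff₀ (by positivity)]
  linarith [h6]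

/-- **Lemma 16:** "For integer `1 ≤ k < n`. If `A(n, k)` holds with constant `0 < C_{n,k} ≤ 1` then
`B(n, k)` holds with constant `D_{n,k} = (k/n) · log_q(1/C_{n,k})`."  Proof as printed (p. 7), by
contradiction: if every onto `φ` has `H^q_∞(φ(U_S)) < δ(n − k) − D`, then every `φ` has a fibre with
`|φ⁻¹(v_φ) ∩ S| > |S| q^D / q^{δ(n−k)} = q^{δk + D}` (eqs. (11), (12)); since every rank-`k` subspace is
a kernel, `S` is `(k, m)`-Furstenberg with `m > q^{δk + D}`, and `A(n, k)` gives
`|S| > C (q^{δk+D})^{n/k} = C q^{(n/k)D} |S| = |S|` (eq. (13)).  (The hypothesis `C ≤ 1`, which makes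
`D ≥ 0`, is not needed for the implication and is omitted.)
[cite: DharDvirLund2021FurstenbergFiniteFields, Lemma 16 (§3, p. 7)] -/
theorem statementB_of_statementA {k : ℕ} (hk : 1 ≤ k) (hkn : k < n) {C : ℝ} (hC0 : 0 < C)
    (hA : StatementA K n k C) :
    StatementB K n k ((k : ℝ) / n * Real.logb (Fintype.card K) (1 / C)) := by
  classical
  intro S hSne
  set q := Fintype.card K with hq
  have hq2 : 1 < q := Fintype.one_lt_card
  have hqR : (1 : ℝ) < q := by exact_mod_cast hq2
  have hkR : (0 : ℝ) < k := by exact_mod_cast hk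
  have hnR : (0 : ℝ) < n := by exact_mod_cast (by omega : 0 < n)
  have hScard : (0 : ℝ) < S.card := by exact_mod_cast hSne.card_pos
  set D := (k : ℝ) / n * Real.logb q (1 / C) with hD
  set δ := Real.logb q S.card / n with hδ
  have hSδ : (q : ℝ) ^ (δ * n) = S.card := by
    rw [hδ, div_mul_cancel₀ _ hnR.ne', Real.rpow_logb (by positivity) hqR.ne' hScard]
  by_contra hcon
  push Not at hcon
  -- every rank-`k` subspace has a translate with more than `q^{δk + D}` points of `S`
  set m₀ : ℕ := ⌊(q : ℝ) ^ (δ * k + D)⌋₊ + 1 with hm₀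
  have hm₀gt : (q : ℝ) ^ (δ * k + D) < m₀ := by
    rw [hm₀]
    push_cast
    exact Nat.lt_floor_add_one _
  have hFur : IsFurstenberg k m₀ (S : Set (Fin n → K)) := by
    intro W hW
    obtain ⟨φ, hφs, hφker⟩ := exists_linearMap_ker_eq (V₂ := Fin (n - k) → K) W (by
      rw [hW, Module.finrank_fintype_fun_eq_card, Fintype.card_fin]; omega)
    have hlt := hcon φ hφs
    -- the mode of `φ(U_S)`
    obtain ⟨y, hy⟩ := exists_eq_maxProb (pushforward φ (uniformOn S))
    obtain ⟨x, rfl⟩ := hφs y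
    refine ⟨x, ?_⟩
    have hset : {z ∈ (S : Set (Fin n → K)) | z - x ∈ W}.ncard =
        (S.filter fun z => φ z = φ x).card := by
      rw [ncard_sep_coe]
      congr 1
      ext z
      simp only [mem_filter, ← hφker, LinearMap.mem_ker, map_sub, sub_eq_zero]
    rw [hset]
    -- `maxProb > q^{D - δ(n-k)}`, i.e. the fibre has more than `q^{δ k + D}` points
    have hMpos : 0 < maxProb (pushforward φ (uniformOn S)) :=
      ((isPMF_uniformOn hSne).pushforward φ).maxProb_pos
    have h1 : D - δ * (n - k) < Real.logb q (maxProb (pushforward φ (uniformOn S))) := by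
      rw [minEntropy] at hlt
      rw [hδ]
      linarith
    have h2 : (q : ℝ) ^ (D - δ * (n - k)) < maxProb (pushforward φ (uniformOn S)) := by
      rw [← Real.logb_lt_logb_iff hqR (by positivity) hMpos, Real.logb_rpow (by positivity) hqR.ne']
      exact h1
    rw [← hy, pushforward_uniformOn, lt_div_iff₀ hScard, ← hSδ, ← Real.rpow_add (by positivity),
      show D - δ * (n - k) + δ * n = δ * k + D by ring] at h2
    have h3 : (m₀ : ℝ) ≤ (S.filter fun z => φ z = φ x).card := by
      rw [hm₀]
      have h4 : ⌊(q : ℝ) ^ (δ * k + D)⌋₊ < (S.filter fun z => φ z = φ x).card := by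
        rw [Nat.floor_lt (by positivity)]
        exact h2
      exact_mod_cast h4
    exact_mod_cast h3
  -- apply `A(n, k)`
  have hAS := hA m₀ S hFur
  have hpow : C * (m₀ : ℝ) ^ ((n : ℝ) / k) > S.card := by
    have h1 : ((q : ℝ) ^ (δ * k + D)) ^ ((n : ℝ) / k) < (m₀ : ℝ) ^ ((n : ℝ) / k) :=
      Real.rpow_lt_rpow (by positivity) hm₀gt (by positivity)
    have h2 : ((q : ℝ) ^ (δ * k + D)) ^ ((n : ℝ) / k) = S.card * (1 / C) := by
      rw [← Real.rpow_mul (by positivity), add_mul,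
        show δ * k * ((n : ℝ) / k) = δ * n by field_simp, Real.rpow_add (by positivity), hSδ, hD,
        show (k : ℝ) / n * Real.logb q (1 / C) * (n / k) = Real.logb q (1 / C) by field_simp,
        Real.rpow_logb (by positivity) hqR.ne' (by positivity)]
    rw [h2] at h1
    have h3 : C * (S.card * (1 / C)) = S.card := by field_simp
    calc C * (m₀ : ℝ) ^ ((n : ℝ) / k) > C * (S.card * (1 / C)) := mul_lt_mul_of_pos_left h1 hC0
      _ = S.card := h3
  linarith

end FurstenbergSets

/-! ### §4: the `ℓⁿ` estimate (Theorem 19) — Claim 20, the finite level (14), the limit -/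
section Claim

variable {n : ℕ}

/-- **Claim 20 (the propagation step of the proof of Theorem 19), with the arithmetic isolated.**
Let `P ≠ 0` have total degree `d* ≤ qm − 1` and vanish at every `x` with multiplicity `N_x`, and
suppose that in every direction `b` (including `b = 0`) some line `a + tb` has
`∑_t N_{a + tb} ≥ (2q − 1) m`.  Then the top homogeneous part `P^H` vanishes at EVERY `b ∈ 𝔽_qⁿ` with
multiplicity at least `m`.  Proof as printed: for `|i| = m' < m` the Hasse derivative `Q = P^{(i)}`
has degree `≤ d* − m'` and multiplicity `≥ N_x − m'` at `x` (DKSS Lemma 2.4), so along the rich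
line `∑_t mult(Q, a + tb) ≥ (2q − 1)m − qm' > qm − 1 − m' ≥ deg Q_{a,b}`; hence `Q_{a,b} ≡ 0`
(`sum_mult_line_le`) and its `t^{d* − m'}`-coefficient `(P^H)^{(i)}(b)` vanishes ("`(P^H)^{(α)}` is
precisely the homogenous part of highest degree of `Q`").  The printed text takes `d = mq − r`
(arXiv v1; the journal text's `d = mq` is a misprint, see the module docstring); here `d = qm − 1`
as in DKSS Theorem 3.2, which only strengthens the finite-level inequality.
[cite: DharDvirLund2021FurstenbergFiniteFields, Claim 20 (proof of Theorem 19, §4, p. 9)] -/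
theorem vanishesToOrder_homogeneousComponent_of_rich_lines [Fintype K] {N : (Fin n → K) → ℕ} {m : ℕ}
    (hline : ∀ b : Fin n → K, ∃ a : Fin n → K,
      (2 * Fintype.card K - 1) * m ≤ ∑ t : K, N (a + t • b))
    {P : MvPolynomial (Fin n) K} (hP0 : P ≠ 0)
    (hPdeg : P.totalDegree ≤ Fintype.card K * m - 1)
    (hmult : ∀ a, VanishesToOrder P a (N a)) (b : Fin n → K) :
    VanishesToOrder (homogeneousComponent P.totalDegree P) b m := by
  classical
  set q := Fintype.card K with hq
  have hq1 : 1 ≤ q := Fintype.card_pos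
  set ds := P.totalDegree with hds
  rw [vanishesToOrder_iff_hasseDeriv]
  intro i hi
  set w := i.degree with hw
  by_cases hwd : ds < w
  · rw [hasseDeriv_homogeneousComponent_eq_zero P hwd, map_zero]
  push Not at hwd
  obtain ⟨a, ha⟩ := hline b
  set Q := hasseDeriv K i P with hQ
  have hQdeg : Q.totalDegree ≤ ds - w := totalDegree_hasseDeriv_le i P
  -- the restriction of `Q` to the line `a + tb` vanishes identically
  have hvan : aeval (fun j => Polynomial.C (a j) + Polynomial.C (b j) * Polynomial.X) Q = 0 := by
    by_contra hne
    have hQ0 : Q ≠ 0 := by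
      rintro hQ0
      exact hne (by rw [hQ0, map_zero])
    -- multiplicities of `Q` along the line
    have hmQ : ∀ t : K, N (a + t • b) - w ≤ mult Q (a + t • b) := fun t =>
      (Nat.sub_le_sub_right ((le_mult_iff hP0).2 (hmult _)) w).trans
        (mult_sub_le_mult_hasseDeriv i hQ0 _)
    have h1 : ∑ t : K, (N (a + t • b) - w) ≤ ds - w :=
      (sum_le_sum fun t _ => hmQ t).trans ((sum_mult_line_le a b Q hne).trans hQdeg)
    have h2 : ∑ t : K, N (a + t • b) ≤ ∑ t : K, (N (a + t • b) - w) + q * w := by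
      have : ∑ t : K, N (a + t • b) ≤ ∑ t : K, ((N (a + t • b) - w) + w) :=
        sum_le_sum fun t _ => le_tsub_add
      rw [sum_add_distrib, sum_const, card_univ, smul_eq_mul] at this
      rw [hq]
      linarith [mul_comm (Fintype.card K) w]
    have h3 : (2 * q - 1) * m + w ≤ q * m - 1 + q * w := by
      have := ha.trans h2
      omega
    have hwm : w ≤ m - 1 := by omega
    have h4 : (q - 1) * w ≤ (q - 1) * (m - 1) := Nat.mul_le_mul_left _ hwm
    have hqm : 1 ≤ q * m := Nat.mul_pos hq1 (by omega)
    zify [hq1, (by omega : 1 ≤ 2 * q), hqm, (by omega : 1 ≤ m)] at h3 h4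
    nlinarith
  have hc := coeff_aeval_line a b Q hQdeg
  rw [hvan, Polynomial.coeff_zero, hQ, homogeneousComponent_hasseDeriv, ← hw,
    show ds - w + w = ds by omega] at hc
  exact hc.symm

/-- **Inequality (14), the finite level of Theorem 19:** under the hypotheses of Claim 20 on the
multiplicities `N_x` (`m ≥ 1`), `C(qm − 1 + n, n) ≤ ∑_x C(N_x + n − 1, n)` — otherwise Lemma 12 gives
`P ≠ 0` of degree `≤ qm − 1` with these multiplicities, Claim 20 makes `P^H` vanish to order `m`
on all of `𝔽_qⁿ`, and Lemma 11 (DKSS Lemma 2.7, `FiniteFieldKakeya.card_mul_sum_mult_le`) forces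
`qm ≤ deg P^H ≤ qm − 1` ("Lemma 11 now implies that `mq ≤ d`, leading to a contradiction", p. 10).
[cite: DharDvirLund2021FurstenbergFiniteFields, Theorem 19 (proof, eq. (14), §4, pp. 8–10)] -/
theorem choose_le_sum_choose [Fintype K] {N : (Fin n → K) → ℕ} {m : ℕ} (hm : 1 ≤ m)
    (hline : ∀ b : Fin n → K, ∃ a : Fin n → K,
      (2 * Fintype.card K - 1) * m ≤ ∑ t : K, N (a + t • b)) :
    (Fintype.card K * m - 1 + n).choose n ≤ ∑ a : Fin n → K, (N a + n - 1).choose n := by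
  classical
  set q := Fintype.card K with hq
  have hq1 : 1 ≤ q := Fintype.card_pos
  by_contra! hlt
  obtain ⟨P, hP0, hPdeg, hmult⟩ := exists_vanishesToOrder_of_sum_choose_lt N (q * m - 1) hlt
  set ds := P.totalDegree with hds
  set H := homogeneousComponent ds P with hH
  have hH0 : H ≠ 0 := homogeneousComponent_totalDegree_ne_zero hP0
  have hHdeg : H.totalDegree ≤ ds := (homogeneousComponent_isHomogeneous ds P).totalDegree_le
  have hHmult : ∀ b : Fin n → K, m ≤ mult H b := fun b =>
    (le_mult_iff hH0).2 (vanishesToOrder_homogeneousComponent_of_rich_lines hline hP0 hPdeg hmult b)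
  have hSZ := card_mul_sum_mult_le H hH0
  have hsum : q ^ n * m ≤ ∑ b : Fin n → K, mult H b := by
    have := Finset.sum_le_sum fun b (_ : b ∈ (univ : Finset (Fin n → K))) => hHmult b
    rwa [Finset.sum_const, Finset.card_univ, Fintype.card_fun, Fintype.card_fin, smul_eq_mul]
      at this
  have h1 : q * (q ^ n * m) ≤ ds * q ^ n :=
    (Nat.mul_le_mul_left _ hsum).trans (hSZ.trans (Nat.mul_le_mul_right _ hHdeg))
  have h2 : ds * q ^ n ≤ (q * m - 1) * q ^ n := Nat.mul_le_mul_right _ hPdeg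
  have hqn : 0 < q ^ n := by positivity
  have h3 : q * m ≤ q * m - 1 := by
    have := h1.trans h2
    rw [show q * (q ^ n * m) = (q * m) * q ^ n by ring] at this
    exact Nat.le_of_mul_le_mul_right this hqn
  have h4 : 1 ≤ q * m := Nat.mul_pos hq1 hm
  omega

end Claim

section NormBound

open Filter Topology

variable {n : ℕ}

/-- The limit used to pass from (14) to Theorem 19 ("As `m` can be arbitrarily large, we let it grow
towards infinity"): if `N_k / k → a` then `C(N_k + n − 1, n) / kⁿ → aⁿ / n!`, because
`n! · C(N + n − 1, n) = ∏_{j<n} (N + j)` (`FiniteFieldKakeya.factorial_mul_choose_eq_prod`).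
[cite: DharDvirLund2021FurstenbergFiniteFields, Theorem 19 (proof, p. 9: the passage to the limit in (14))] -/
theorem tendsto_choose_div_pow (n : ℕ) {N : ℕ → ℕ} {a : ℝ}
    (h : Tendsto (fun k : ℕ => (N k : ℝ) / k) atTop (𝓝 a)) :
    Tendsto (fun k : ℕ => ((N k + n - 1).choose n : ℝ) / (k : ℝ) ^ n) atTop
      (𝓝 (a ^ n / n.factorial)) := by
  have hfac : (n.factorial : ℝ) ≠ 0 := by positivity
  have hprod : ∀ k : ℕ, ((N k + n - 1).choose n : ℝ) / (k : ℝ) ^ n =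
      (∏ j ∈ Finset.range n, (((N k : ℝ) + j) / k)) / n.factorial := by
    intro k
    have hC : ((N k + n - 1).choose n : ℝ) =
        (∏ j ∈ Finset.range n, ((N k : ℝ) + j)) / n.factorial := by
      rw [eq_div_iff hfac, mul_comm]
      exact factorial_mul_choose_eq_prod (N k) n
    rw [hC, Finset.prod_div_distrib, Finset.prod_const, Finset.card_range, div_right_comm]
  have hfac' : ∀ j : ℕ, Tendsto (fun k : ℕ => ((N k : ℝ) + j) / k) atTop (𝓝 a) := by
    intro j
    have h0 : Tendsto (fun k : ℕ => (j : ℝ) / k) atTop (𝓝 0) :=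
      tendsto_const_div_atTop_nhds_zero_nat _
    have := h.add h0
    rw [add_zero] at this
    refine this.congr' (Eventually.of_forall fun k => ?_)
    exact (add_div _ _ _).symm
  have hlim : Tendsto (fun k : ℕ => ∏ j ∈ Finset.range n, (((N k : ℝ) + j) / k)) atTop
      (𝓝 (a ^ n)) := by
    have := tendsto_finsetProd (Finset.range n) fun j (_ : j ∈ Finset.range n) => hfac' j
    simpa [Finset.prod_const, Finset.card_range] using this
  refine (hlim.div_const (n.factorial : ℝ)).congr' (Eventually.of_forall fun k => ?_)
  exact (hprod k).symm

/-- **Theorem 19 for real-valued `f` and real `r ≥ 0`** ("this theorem can easily be generalized to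
real valued functions and positive real `r` by taking ratios and limits", p. 8), in the form
`(rq)ⁿ ≤ (2q − 1)ⁿ · ∑_x |f(x)|ⁿ`: if in every direction `v ≠ 0` some line `a + tv` has
`∑_t |f(a + tv)| ≥ r`, then `∑_x |f(x)|ⁿ ≥ rⁿ/(2 − 1/q)ⁿ`.  Proof as printed (§4), run directly with
real weights: at level `k` take `m = ⌊kr⌋`, `N_x = ⌈(2q − 1) k |f(x)|⌉`, `d = qm − 1`; the direction
`b = 0` of Claim 20 is served by a point with `|f| ≥ r/q` on a rich line; (14) holds for all large
`k` (`choose_le_sum_choose`), and dividing by `kⁿ` and letting `k → ∞` (`tendsto_choose_div_pow`)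
gives `(qr)ⁿ/n! ≤ ∑_x ((2q − 1)|f(x)|)ⁿ/n!`.  (This replaces the paper's two limiting arguments —
`m → ∞` for integer `f`, then rational approximation of real weights — by one.)
[cite: DharDvirLund2021FurstenbergFiniteFields, Theorem 19 (§4, p. 8) and the remark following it] -/
theorem mul_card_pow_le_sum_abs_pow [Fintype K] [DecidableEq K] (f : (Fin n → K) → ℝ) {r : ℝ} (hr : 0 ≤ r)
    (hline : ∀ v : Fin n → K, v ≠ 0 → ∃ a : Fin n → K, r ≤ ∑ t : K, |f (a + t • v)|) :
    (r * Fintype.card K) ^ n ≤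
      (2 * Fintype.card K - 1) ^ n * ∑ x : Fin n → K, |f x| ^ n := by
  classical
  set q := Fintype.card K with hq
  have hq2 : 1 < q := Fintype.one_lt_card
  have hqR : (1 : ℝ) < q := by exact_mod_cast hq2
  -- `n = 0`
  rcases Nat.eq_zero_or_pos n with rfl | hn
  · simp
  -- `r = 0`
  rcases hr.eq_or_lt with h0 | hr0
  · rw [← h0, zero_mul, zero_pow hn.ne']
    exact mul_nonneg (pow_nonneg (by linarith) _)
      (Finset.sum_nonneg fun x _ => pow_nonneg (abs_nonneg _) _)
  -- a point where `|f| ≥ r / q` (from a rich line in a nonzero direction)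
  have hpt : ∃ x₀ : Fin n → K, r / q ≤ |f x₀| := by
    set v₀ : Fin n → K := fun _ => 1 with hv₀
    have hv₀0 : v₀ ≠ 0 := by
      intro h
      have := congr_fun h ⟨0, hn⟩
      simp [hv₀] at this
    obtain ⟨a, ha⟩ := hline v₀ hv₀0
    by_contra hcon
    push Not at hcon
    have hlt : ∑ t : K, |f (a + t • v₀)| < ∑ _t : K, r / q :=
      Finset.sum_lt_sum_of_nonempty Finset.univ_nonempty fun t _ => hcon _
    rw [Finset.sum_const, Finset.card_univ, nsmul_eq_mul, ← hq,
      mul_div_cancel₀ _ (by positivity : (q : ℝ) ≠ 0)] at hlt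
    linarith
  obtain ⟨x₀, hx₀⟩ := hpt
  -- parameters at level `k`: `m = ⌊kr⌋`, `N_x = ⌈(2q − 1) k |f x|⌉`, `d = qm − 1`
  set c : ℕ := 2 * q - 1 with hc
  have hc1 : (c : ℝ) = 2 * q - 1 := by
    rw [hc, Nat.cast_sub (by omega), Nat.cast_mul, Nat.cast_two, Nat.cast_one]
  have hcpos : (0 : ℝ) < c := by rw [hc1]; linarith
  set m : ℕ → ℕ := fun k => ⌊r * k⌋₊ with hm
  set N : ℕ → (Fin n → K) → ℕ := fun k x => ⌈c * |f x| * k⌉₊ with hN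
  -- the line hypothesis at level `k`, including the direction `b = 0`
  have hlineN : ∀ k : ℕ, ∀ b : Fin n → K, ∃ a : Fin n → K,
      c * m k ≤ ∑ t : K, N k (a + t • b) := by
    intro k b
    have hmk : ((m k : ℕ) : ℝ) ≤ r * k := Nat.floor_le (by positivity)
    have hNk : ∀ x, c * |f x| * k ≤ (N k x : ℝ) := fun x => Nat.le_ceil _
    by_cases hb : b = 0
    · refine ⟨x₀, ?_⟩
      have h1 : ∑ t : K, N k (x₀ + t • b) = q * N k x₀ := by
        simp [hb, hq]
      rw [h1]
      have : (c : ℝ) * (m k : ℝ) ≤ (q : ℝ) * (N k x₀ : ℝ) :=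
        calc (c : ℝ) * m k ≤ c * (r * k) := by gcongr
          _ = q * (c * (r / q) * k) := by field_simp
          _ ≤ q * (c * |f x₀| * k) := by gcongr
          _ ≤ q * N k x₀ := by gcongr; exact hNk x₀
      exact_mod_cast this
    · obtain ⟨a, ha⟩ := hline b hb
      refine ⟨a, ?_⟩
      have : (c : ℝ) * (m k : ℝ) ≤ ∑ t : K, (N k (a + t • b) : ℝ) :=
        calc (c : ℝ) * m k ≤ c * (r * k) := by gcongr
          _ ≤ c * ((∑ t : K, |f (a + t • b)|) * k) := by gcongr
          _ = ∑ t : K, c * |f (a + t • b)| * k := by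
              rw [Finset.sum_mul, Finset.mul_sum]
              exact Finset.sum_congr rfl fun t _ => by ring
          _ ≤ ∑ t : K, (N k (a + t • b) : ℝ) := Finset.sum_le_sum fun t _ => hNk _
      exact_mod_cast this
  -- eventually `m ≥ 1`
  have hev : ∀ᶠ k : ℕ in atTop, 1 ≤ m k := by
    filter_upwards [eventually_ge_atTop ⌈1 / r⌉₊] with k hk
    have h1 : (⌈1 / r⌉₊ : ℝ) ≤ k := by exact_mod_cast hk
    have h2 : 1 / r ≤ ⌈1 / r⌉₊ := Nat.le_ceil _
    have h3 : (1 : ℝ) ≤ r * k := by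
      have := h2.trans h1
      rw [div_le_iff₀ hr0] at this
      linarith
    exact Nat.le_floor (by exact_mod_cast h3)
  -- the finite-level inequality, divided by `kⁿ`
  have hfin : ∀ᶠ k : ℕ in atTop, ((q * m k - 1 + n).choose n : ℝ) / (k : ℝ) ^ n ≤
      ∑ x : Fin n → K, ((N k x + n - 1).choose n : ℝ) / (k : ℝ) ^ n := by
    filter_upwards [hev] with k hk
    have h := choose_le_sum_choose hk (hlineN k)
    rw [← Finset.sum_div]
    exact div_le_div_of_nonneg_right (by exact_mod_cast h) (by positivity)
  -- the limits of both sides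
  have hm_lim : Tendsto (fun k : ℕ => ((q * m k : ℕ) : ℝ) / k) atTop (𝓝 (q * r)) := by
    have h1 : Tendsto (fun k : ℕ => (⌊r * (k : ℝ)⌋₊ : ℝ) / (k : ℝ)) atTop (𝓝 r) :=
      (tendsto_nat_floor_mul_div_atTop hr).comp tendsto_natCast_atTop_atTop
    refine (h1.const_mul (q : ℝ)).congr' (Eventually.of_forall fun k => ?_)
    simp only [hm]
    push_cast
    ring
  have hLHS : Tendsto (fun k : ℕ => ((q * m k - 1 + n).choose n : ℝ) / (k : ℝ) ^ n) atTop
      (𝓝 ((q * r) ^ n / n.factorial)) := by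
    refine (tendsto_choose_div_pow n hm_lim).congr' ?_
    filter_upwards [hev] with k hk
    have : 1 ≤ q * m k := Nat.mul_pos (by omega) hk
    rw [show q * m k - 1 + n = q * m k + n - 1 by omega]
  have hN_lim : ∀ x, Tendsto (fun k : ℕ => ((N k x : ℕ) : ℝ) / k) atTop (𝓝 (c * |f x|)) := by
    intro x
    have h1 := (tendsto_nat_ceil_mul_div_atTop (by positivity : (0 : ℝ) ≤ c * |f x|)).comp
      tendsto_natCast_atTop_atTop
    exact h1.congr' (Eventually.of_forall fun k => by simp [hN])
  have hRHS : Tendsto (fun k : ℕ => ∑ x : Fin n → K, ((N k x + n - 1).choose n : ℝ) / (k : ℝ) ^ n)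
      atTop (𝓝 (∑ x : Fin n → K, (c * |f x|) ^ n / n.factorial)) :=
    tendsto_finsetSum _ fun x _ => tendsto_choose_div_pow n (hN_lim x)
  have hle := le_of_tendsto_of_tendsto hLHS hRHS hfin
  rw [← Finset.sum_div, div_le_div_iff_of_pos_right (by positivity)] at hle
  calc (r * (q : ℝ)) ^ n = (q * r) ^ n := by ring
    _ ≤ ∑ x : Fin n → K, (c * |f x|) ^ n := hle
    _ = (2 * (q : ℝ) - 1) ^ n * ∑ x : Fin n → K, |f x| ^ n := by
        rw [Finset.mul_sum]
        exact Finset.sum_congr rfl fun x _ => by rw [mul_pow, hc1]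

/-- **Theorem 19, printed shape, real weights:** `∑_x |f(x)|ⁿ ≥ rⁿ/(2 − q⁻¹)ⁿ` whenever every
direction has a line with `∑ |f| ≥ r` (`r ≥ 0` real, `f` real-valued).
[cite: DharDvirLund2021FurstenbergFiniteFields, Theorem 19 (§4, p. 8) and the remark following it] -/
theorem div_pow_le_sum_abs_pow [Fintype K] [DecidableEq K] (f : (Fin n → K) → ℝ) {r : ℝ}
    (hr : 0 ≤ r)
    (hline : ∀ v : Fin n → K, v ≠ 0 → ∃ a : Fin n → K, r ≤ ∑ t : K, |f (a + t • v)|) :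
    (r / (2 - 1 / Fintype.card K)) ^ n ≤ ∑ x : Fin n → K, |f x| ^ n := by
  have h := mul_card_pow_le_sum_abs_pow f hr hline
  have hq : (1 : ℝ) < Fintype.card K := by exact_mod_cast Fintype.one_lt_card
  have hpos : (0 : ℝ) < 2 * Fintype.card K - 1 := by linarith
  have heq : r / (2 - 1 / Fintype.card K) = r * Fintype.card K / (2 * Fintype.card K - 1) := by
    field_simp
  rw [heq, div_pow, div_le_iff₀ (by positivity)]
  exact h.trans_eq (mul_comm _ _)

/-- **Theorem 19, as printed:** "Given `r ∈ ℤ_{≥0}` and a function `f : 𝔽_qⁿ → ℤ` such that for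
every direction `γ` there exists a line `E_γ` in that direction such that `∑_{x ∈ E_γ} |f(x)| ≥ r` we
have the following bound, `‖f‖_{ℓⁿ}ⁿ = ∑_{x ∈ 𝔽_qⁿ} |f(x)|ⁿ ≥ rⁿ/(2 − q⁻¹)ⁿ`."  ("Note, if `f` is an
indicator function for a subset of `𝔽_qⁿ` and `r = q` then the theorem above is simply the Kakeya
bound in [DKSS]" — that case is `FiniteFieldKakeya.div_pow_le_card_of_isKakeya`.)
[cite: DharDvirLund2021FurstenbergFiniteFields, Theorem 19 (§4, p. 8)] -/
theorem div_pow_le_sum_abs_pow_int [Fintype K] [DecidableEq K] (f : (Fin n → K) → ℤ) (r : ℕ)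
    (hline : ∀ v : Fin n → K, v ≠ 0 → ∃ a : Fin n → K, (r : ℤ) ≤ ∑ t : K, |f (a + t • v)|) :
    (r : ℝ) ^ n / (2 - 1 / Fintype.card K) ^ n ≤ ∑ x : Fin n → K, (|f x| : ℝ) ^ n := by
  have h := div_pow_le_sum_abs_pow (fun x => (f x : ℝ)) (Nat.cast_nonneg r) fun v hv => by
    obtain ⟨a, ha⟩ := hline v hv
    refine ⟨a, ?_⟩
    have : ((r : ℤ) : ℝ) ≤ ((∑ t : K, |f (a + t • v)| : ℤ) : ℝ) := by exact_mod_cast ha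
    push_cast at this
    exact this
  rw [← div_pow]
  simpa [Int.cast_abs] using h

end NormBound

/-! ### §4: the entropic bound for `k = 1` (Theorem 18) -/
section EntropicKakeya

variable [Fintype K] [DecidableEq K]

omit [Fintype K] [DecidableEq K] in
/-- "Given any onto linear map `φ : 𝔽_qⁿ → 𝔽_q^{n−1}`, its kernel is some line passing through the
origin with direction `γ`" — conversely, for every direction `γ ≠ 0` there is an onto linear map
`𝔽_q^{m+1} → 𝔽_q^m` whose fibres are exactly the lines in direction `γ` (the quotient by `𝔽_q γ`
followed by a linear isomorphism with `𝔽_q^m`). [cite: DharDvirLund2021FurstenbergFiniteFields, Theorem 18 (proof, §4, p. 10)] -/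
theorem exists_linearMap_fiber_eq_line {m : ℕ} {γ : Fin (m + 1) → K} (hγ : γ ≠ 0) :
    ∃ φ : (Fin (m + 1) → K) →ₗ[K] (Fin m → K), Function.Surjective φ ∧
      ∀ x y, φ x = φ y ↔ ∃ t : K, x = y + t • γ := by
  obtain ⟨φ, hφs, hker⟩ := exists_linearMap_ker_eq (V₂ := Fin m → K) (K ∙ γ) (by
    rw [finrank_span_singleton hγ, Module.finrank_fintype_fun_eq_card, Fintype.card_fin, add_comm])
  refine ⟨φ, hφs, fun x y => ?_⟩
  rw [← sub_eq_zero, ← map_sub, ← LinearMap.mem_ker, hker, Submodule.mem_span_singleton]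
  constructor
  · rintro ⟨t, ht⟩
    exact ⟨t, by rw [ht]; abel⟩
  · rintro ⟨t, ht⟩
    exact ⟨t, by rw [ht]; abel⟩

/-- "for every `x ∈ 𝔽_q^{n−1}`, `Pr(φ(R) = x)` is obtained by summing `Pr(R = y)` over all `y` in the
line through `x` in direction `γ`": the fibre of such a `φ` over `φ(x₀)` is the line `x₀ + tγ`, so
the pushforward mass is the line sum. [cite: DharDvirLund2021FurstenbergFiniteFields, Theorem 18 (proof, §4, p. 10)] -/
theorem pushforward_apply_eq_sum_line {m : ℕ} {γ : Fin (m + 1) → K} (hγ : γ ≠ 0)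
    {φ : (Fin (m + 1) → K) →ₗ[K] (Fin m → K)}
    (hφ : ∀ x y, φ x = φ y ↔ ∃ t : K, x = y + t • γ)
    (p : (Fin (m + 1) → K) → ℝ) (x₀ : Fin (m + 1) → K) :
    pushforward φ p (φ x₀) = ∑ t : K, p (x₀ + t • γ) := by
  rw [pushforward_apply]
  have hset : (univ.filter fun x => φ x = φ x₀) = univ.image (fun t : K => x₀ + t • γ) := by
    ext x
    simp only [mem_filter, mem_univ, true_and, mem_image]
    rw [hφ]
    constructor
    · rintro ⟨t, ht⟩
      exact ⟨t, ht.symm⟩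
    · rintro ⟨t, ht⟩
      exact ⟨t, ht.symm⟩
  rw [hset, Finset.sum_image]
  intro s _ t _ hst
  exact smul_left_injective K hγ (add_left_cancel hst)

/-- **Theorem 18 (Entropic bound for `k = 1`):** "For any random variable `R` supported over
`𝔽_qⁿ` there exists an onto linear map `φ : 𝔽_qⁿ → 𝔽_q^{n−1}` such that
`H^q_∞(φ(R)) ≥ ((n−1)/n) H^q_∞(R) − log_q(2 − q⁻¹)`."  Here `n = m + 1` and `R` is given by its law
`p` (any real probability mass function — no rationality assumption).  Proof as printed (§4,
p. 10): pick the direction `γ₀` minimising the maximal line sum `r = max_{ℓ ∥ γ₀} ∑_{x ∈ ℓ} p(x)`;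
then every direction has a line of mass `≥ r`, Theorem 19 gives `rⁿ/(2 − q⁻¹)ⁿ ≤ ∑_x p(x)ⁿ ≤
p(v)^{n−1}` (`v` the mode, eq. (18)), and the map with kernel `𝔽_q γ₀` has all fibre masses `≤ r`.
[cite: DharDvirLund2021FurstenbergFiniteFields, Theorem 18 (§3, p. 8; proof §4, p. 10)] -/
theorem entropic_kakeya {m : ℕ} (p : (Fin (m + 1) → K) → ℝ) (hp : IsPMF p) :
    ∃ φ : (Fin (m + 1) → K) →ₗ[K] (Fin m → K), Function.Surjective φ ∧
      (m : ℝ) / (m + 1) * minEntropy (Fintype.card K) p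
          - Real.logb (Fintype.card K) (2 - 1 / Fintype.card K)
        ≤ minEntropy (Fintype.card K) (pushforward φ p) := by
  classical
  set q := Fintype.card K with hq
  have hq2 : 1 < q := Fintype.one_lt_card
  have hqR : (1 : ℝ) < q := by exact_mod_cast hq2
  have hcq : (0 : ℝ) < 2 - 1 / q := by
    have : (1 : ℝ) / q < 1 := by
      rw [div_lt_one (by positivity)]
      exact hqR
    linarith
  -- maximal line sums `L(v) = max_a ∑_t p(a + tv)` and the best direction `γ₀`
  let L : (Fin (m + 1) → K) → ℝ := fun v =>
    (univ : Finset (Fin (m + 1) → K)).sup' univ_nonempty fun a => ∑ t : K, p (a + t • v)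
  set D := (univ : Finset (Fin (m + 1) → K)).filter (fun v => v ≠ 0) with hD
  have hDne : D.Nonempty := by
    refine ⟨fun _ => 1, ?_⟩
    rw [hD, mem_filter]
    refine ⟨mem_univ _, fun h => ?_⟩
    have := congr_fun h 0
    simp at this
  obtain ⟨γ₀, hγ₀D, hmin⟩ := Finset.exists_min_image D L hDne
  have hγ₀ : γ₀ ≠ 0 := (mem_filter.1 hγ₀D).2
  set r := L γ₀ with hr
  have hline : ∀ v : Fin (m + 1) → K, v ≠ 0 → ∃ a, r ≤ ∑ t : K, |p (a + t • v)| := by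
    intro v hv
    obtain ⟨a, _, ha⟩ := exists_mem_eq_sup' (univ_nonempty (α := Fin (m + 1) → K))
      (fun a => ∑ t : K, p (a + t • v))
    refine ⟨a, ?_⟩
    have h1 : r ≤ L v := hmin v (mem_filter.2 ⟨mem_univ _, hv⟩)
    have h2 : L v = ∑ t : K, p (a + t • v) := ha
    rw [h2] at h1
    exact h1.trans (Finset.sum_le_sum fun t _ => le_abs_self _)
  have hr0 : 0 ≤ r := by
    have h1 : (0 : ℝ) ≤ ∑ t : K, p ((0 : Fin (m + 1) → K) + t • γ₀) :=
      Finset.sum_nonneg fun t _ => hp.1 _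
    exact h1.trans (Finset.le_sup' (fun a => ∑ t : K, p (a + t • γ₀)) (mem_univ 0))
  -- Theorem 19 and `∑ p(x)^{m+1} ≤ M^m`
  have h19 := div_pow_le_sum_abs_pow p hr0 hline
  set M := maxProb p with hM
  have hMpos : 0 < M := hp.maxProb_pos
  have hsum : ∑ x : Fin (m + 1) → K, |p x| ^ (m + 1) ≤ M ^ m := by
    calc ∑ x : Fin (m + 1) → K, |p x| ^ (m + 1) = ∑ x, p x ^ m * p x := by
          refine Finset.sum_congr rfl fun x _ => ?_
          rw [abs_of_nonneg (hp.1 x), pow_succ]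
      _ ≤ ∑ x : Fin (m + 1) → K, M ^ m * p x := by
          refine Finset.sum_le_sum fun x _ => ?_
          exact mul_le_mul_of_nonneg_right (pow_le_pow_left₀ (hp.1 x) (le_maxProb p x) m)
            (hp.1 x)
      _ = M ^ m := by rw [← Finset.mul_sum, hp.2, mul_one]
  have hkey : (r / (2 - 1 / q)) ^ (m + 1) ≤ M ^ m := h19.trans hsum
  -- the map with kernel `K γ₀`
  obtain ⟨φ, hφs, hφ⟩ := exists_linearMap_fiber_eq_line hγ₀
  refine ⟨φ, hφs, ?_⟩
  set M' := maxProb (pushforward φ p) with hM'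
  have hM'pos : 0 < M' := (hp.pushforward φ).maxProb_pos
  have hM'r : M' ≤ r := by
    refine maxProb_le fun y => ?_
    obtain ⟨x₀, rfl⟩ := hφs y
    rw [pushforward_apply_eq_sum_line hγ₀ hφ p x₀]
    exact Finset.le_sup' (fun a => ∑ t : K, p (a + t • γ₀)) (mem_univ x₀)
  have hrpos : 0 < r := hM'pos.trans_le hM'r
  rw [minEntropy, minEntropy, ← hM, ← hM']
  have h1 : Real.logb q M' ≤ Real.logb q r := Real.logb_le_logb_of_le hqR hM'pos hM'r
  have h2 : ((m : ℝ) + 1) * (Real.logb q r - Real.logb q (2 - 1 / q)) ≤ m * Real.logb q M := by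
    have := Real.logb_le_logb_of_le hqR (by positivity) hkey
    rw [Real.logb_pow, Real.logb_pow, Real.logb_div hrpos.ne' hcq.ne'] at this
    push_cast at this
    exact this
  have hm1 : (0 : ℝ) < m + 1 := by positivity
  have h3 : Real.logb q r - Real.logb q (2 - 1 / q) ≤ m * Real.logb q M / (m + 1) :=
    (le_div_iff₀ hm1).2 (by linarith [h2])
  have h4 : (m : ℝ) / (m + 1) * -Real.logb q M = -(m * Real.logb q M / (m + 1)) := by ring
  rw [h4]
  linarith [h1, h3]

end EntropicKakeya

/-! ### §5: the general entropic bound (Theorem 17) -/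
section EntropicFurstenberg

variable [Fintype K] [DecidableEq K]

omit [Fintype K] [DecidableEq K] in
/-- The pushforward along the identity is the identity. [folklore] -/
private theorem pushforward_id {α : Type*} [Fintype α] [DecidableEq α] (p : α → ℝ) :
    pushforward (fun x : α => x) p = p := by
  funext y
  rw [pushforward_apply, Finset.filter_eq' univ y, if_pos (mem_univ y), sum_singleton]

/-- **Theorem 17 (Entropic-Furstenberg bound):** "For any random variable `R` supported over `𝔽_qⁿ`
there exists an onto linear map `φ : 𝔽_qⁿ → 𝔽_q^{n−k}` such that
`H^q_∞(φ(R)) ≥ ((n−k)/n) H^q_∞(R) − log_q(2 − q⁻¹) k`."  Stated with `n = m + k` (so that no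
index arithmetic enters the types); see `entropic_furstenberg'` for the form with `n` and `n − k`.
Proof as printed (§5, p. 11): induction on `k` "composing a sequence of onto maps" — here the
line map of Theorem 18 on `𝔽_q^{m+k+1}` is composed with the inductively given map on `𝔽_q^{m+k}`
(the printed order is the reverse; the estimate is the same substitution of (19) into (20)), and
`k = 0` (the identity) is the base.
[cite: DharDvirLund2021FurstenbergFiniteFields, Theorem 17 (§3, p. 8; proof §5, p. 11)] -/
theorem entropic_furstenberg (k : ℕ) :
    ∀ (m : ℕ) (p : (Fin (m + k) → K) → ℝ), IsPMF p →
      ∃ φ : (Fin (m + k) → K) →ₗ[K] (Fin m → K), Function.Surjective φ ∧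
        (m : ℝ) / ((m + k : ℕ) : ℝ) * minEntropy (Fintype.card K) p
            - k * Real.logb (Fintype.card K) (2 - 1 / Fintype.card K)
          ≤ minEntropy (Fintype.card K) (pushforward φ p) := by
  set q := Fintype.card K with hq
  have hq2 : 1 < q := Fintype.one_lt_card
  have hqR : (1 : ℝ) < q := by exact_mod_cast hq2
  have hc0 : 0 ≤ Real.logb q (2 - 1 / q) := by
    refine Real.logb_nonneg hqR ?_
    have : (1 : ℝ) / q ≤ 1 := by
      rw [div_le_one (by positivity)]
      exact hqR.le
    linarith
  induction k with
  | zero =>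
      intro m p hp
      refine ⟨LinearMap.id, Function.surjective_id, ?_⟩
      have hid : pushforward (⇑(LinearMap.id : (Fin (m + 0) → K) →ₗ[K] (Fin m → K))) p = p :=
        pushforward_id p
      rw [hid]
      have hH : 0 ≤ minEntropy q p := hp.minEntropy_nonneg hq2
      simp only [Nat.cast_zero, add_zero, zero_mul, sub_zero]
      exact mul_le_of_le_one_left hH (div_self_le_one _)
  | succ k ih =>
      intro m p hp
      -- first a line (Theorem 18 on `𝔽^{m+k+1}`), then the inductive map on `𝔽^{m+k}`
      obtain ⟨ψ, hψs, hψ⟩ := entropic_kakeya (m := m + k) p hp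
      obtain ⟨φ, hφs, hφ⟩ := ih m (pushforward ψ p) (hp.pushforward ψ)
      refine ⟨φ ∘ₗ ψ, hφs.comp hψs, ?_⟩
      rw [LinearMap.coe_comp, pushforward_comp]
      set H := minEntropy q p
      set H1 := minEntropy q (pushforward ψ p)
      set H2 := minEntropy q (pushforward φ (pushforward ψ p))
      set c := Real.logb q (2 - 1 / q)
      set a : ℝ := (m : ℝ) / ((m + k : ℕ) : ℝ) with ha
      have ha0 : 0 ≤ a := by positivity
      have ha1 : a ≤ 1 := by
        rw [ha]
        refine div_le_one_of_le₀ ?_ (by positivity)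
        push_cast
        linarith
      have hb : ((m + k : ℕ) : ℝ) / ((m + k : ℕ) + 1) * H - c ≤ H1 := hψ
      have h3 : a * (((m + k : ℕ) : ℝ) / ((m + k : ℕ) + 1) * H - c) ≤ a * H1 :=
        mul_le_mul_of_nonneg_left hb ha0
      have hab : a * (((m + k : ℕ) : ℝ) / ((m + k : ℕ) + 1)) =
          (m : ℝ) / ((m + (k + 1) : ℕ) : ℝ) := by
        rw [ha]
        rcases Nat.eq_zero_or_pos (m + k) with hmk | hmk
        · have hm0 : m = 0 := by omega
          simp [hm0]
        · have : ((m + k : ℕ) : ℝ) ≠ 0 := by positivity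
          push_cast at this ⊢
          field_simp
          ring
      have hac : a * c ≤ c := mul_le_of_le_one_left hc0 ha1
      have h4 : a * (((m + k : ℕ) : ℝ) / ((m + k : ℕ) + 1) * H - c) =
          (m : ℝ) / ((m + (k + 1) : ℕ) : ℝ) * H - a * c := by
        rw [← hab]
        ring
      rw [h4] at h3
      push_cast at h3 hφ ⊢
      linarith

/-- **Theorem 17** with the printed indices: for `k ≤ n` and any law `p` on `𝔽_qⁿ` there is an onto
linear map `φ : 𝔽_qⁿ → 𝔽_q^{n−k}` with `H^q_∞(φ(R)) ≥ ((n − k)/n) H^q_∞(R) − k log_q(2 − q⁻¹)`.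
[cite: DharDvirLund2021FurstenbergFiniteFields, Theorem 17 (§3, p. 8)] -/
theorem entropic_furstenberg' {n k : ℕ} (hkn : k ≤ n) (p : (Fin n → K) → ℝ) (hp : IsPMF p) :
    ∃ φ : (Fin n → K) →ₗ[K] (Fin (n - k) → K), Function.Surjective φ ∧
      ((n : ℝ) - k) / n * minEntropy (Fintype.card K) p
          - k * Real.logb (Fintype.card K) (2 - 1 / Fintype.card K)
        ≤ minEntropy (Fintype.card K) (pushforward φ p) := by
  obtain ⟨m, rfl⟩ : ∃ m, n = m + k := ⟨n - k, by omega⟩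
  rw [Nat.add_sub_cancel]
  obtain ⟨φ, hφs, hφ⟩ := entropic_furstenberg k m p hp
  refine ⟨φ, hφs, ?_⟩
  convert hφ using 3
  push_cast
  ring

end EntropicFurstenberg

/-! ### §1, §3: Theorem 1 -/
section MainTheorem

variable {n : ℕ} [Fintype K] [DecidableEq K]

/-- "Theorem 17 proves the statement `B(n, k)`" — with the constant `D_{n,k} = k log_q(2 − q⁻¹)`
(apply Theorem 17 to `U_S`, whose min-entropy is `log_q |S|`). [cite: DharDvirLund2021FurstenbergFiniteFields, proof of Theorem 1 (§3, p. 8)] -/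
theorem statementB_entropic {k : ℕ} (hkn : k ≤ n) :
    StatementB K n k (k * Real.logb (Fintype.card K) (2 - 1 / Fintype.card K)) := by
  intro S hS
  obtain ⟨φ, hφs, hφ⟩ := entropic_furstenberg' hkn (uniformOn S) (isPMF_uniformOn hS)
  refine ⟨φ, hφs, ?_⟩
  rw [minEntropy_uniformOn _ hS] at hφ
  convert hφ using 2
  ring

/-- "Theorem 17 proves the statement `B(n, k)` with constant `D_{n,k} = k log_q(2)`" (as
`log_q(2 − q⁻¹) ≤ log_q 2`). [cite: DharDvirLund2021FurstenbergFiniteFields, proof of Theorem 1 (§3, p. 8)] -/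
theorem statementB_entropic_two {k : ℕ} (hkn : k ≤ n) :
    StatementB K n k (k * Real.logb (Fintype.card K) 2) := by
  refine (statementB_entropic hkn).mono ?_
  have hqR : (1 : ℝ) < Fintype.card K := by exact_mod_cast Fintype.one_lt_card
  refine mul_le_mul_of_nonneg_left ?_ (Nat.cast_nonneg k)
  refine Real.logb_le_logb_of_le hqR ?_ (by linarith [show (0:ℝ) < 1 / Fintype.card K by positivity])
  have : (1 : ℝ) / Fintype.card K ≤ 1 := by
    rw [div_le_one (by positivity)]
    exact hqR.le
  linarith

/-- **Theorem 1 with the constant the proof gives:** every `(k, m)`-Furstenberg set `S ⊆ 𝔽_qⁿ`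
(`1 ≤ k < n`) has `|S| ≥ m^{n/k} / (2 − q⁻¹)ⁿ` — Lemma 15 applied to `B(n, k)` with
`D = k log_q(2 − q⁻¹)`, since `q^{−(n/k) · k log_q(2 − q⁻¹)} = (2 − q⁻¹)^{−n}`.
[cite: DharDvirLund2021FurstenbergFiniteFields, Theorem 1 (§1, p. 2) with Theorem 17 (p. 8)] -/
theorem rpow_div_pow_le_card {k m : ℕ} (hk : 1 ≤ k) (hkn : k < n) (S : Finset (Fin n → K))
    (hS : IsFurstenberg k m (S : Set (Fin n → K))) :
    (m : ℝ) ^ ((n : ℝ) / k) / (2 - 1 / Fintype.card K) ^ n ≤ S.card := by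
  set q := Fintype.card K with hq
  have hq2 : 1 < q := Fintype.one_lt_card
  have hqR : (1 : ℝ) < q := by exact_mod_cast hq2
  have hb : (0 : ℝ) < 2 - 1 / q := by
    have : (1 : ℝ) / q < 1 := by
      rw [div_lt_one (by positivity)]
      exact hqR
    linarith
  have hA := statementA_of_statementB hk hkn (statementB_entropic hkn.le) m S hS
  have hkR : (k : ℝ) ≠ 0 := by exact_mod_cast (show k ≠ 0 by omega)
  have hC : (q : ℝ) ^ (-((n : ℝ) / k) * (k * Real.logb q (2 - 1 / q))) =
      ((2 - 1 / (q : ℝ)) ^ n)⁻¹ := by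
    rw [show -((n : ℝ) / k) * (k * Real.logb q (2 - 1 / q)) =
        -(Real.logb q (2 - 1 / q) * n) by field_simp,
      Real.rpow_neg (by positivity), Real.rpow_mul (by positivity), Real.rpow_natCast,
      Real.rpow_logb (by positivity) hqR.ne' hb]
  rw [hC, inv_mul_eq_div] at hA
  exact hA

/-- **Theorem 1:** "Let `q` be a prime power, and let `n, k,` and `m` be positive integers such that
`m ≤ q^k`, then `K(q, n, k, m) ≥ (1/2ⁿ) m^{n/k}`" — in the form: every `(k, m)`-Furstenberg set
`S ⊆ 𝔽_qⁿ` with `1 ≤ k < n` has `m^{n/k}/2ⁿ ≤ |S|` (the standing assumption `n > k ≥ 1` is from §1;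
`m ≤ q^k` is only needed for `K(q, n, k, m)` to be defined, see
`rpow_div_two_pow_le_furstenbergNumber`). [cite: DharDvirLund2021FurstenbergFiniteFields, Theorem 1 (§1, p. 2)] -/
theorem rpow_div_two_pow_le_card {k m : ℕ} (hk : 1 ≤ k) (hkn : k < n) (S : Finset (Fin n → K))
    (hS : IsFurstenberg k m (S : Set (Fin n → K))) :
    (m : ℝ) ^ ((n : ℝ) / k) / 2 ^ n ≤ S.card := by
  refine le_trans ?_ (rpow_div_pow_le_card hk hkn S hS)
  have hqR : (1 : ℝ) < Fintype.card K := by exact_mod_cast Fintype.one_lt_card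
  have h1 : (0 : ℝ) < 1 / Fintype.card K := by positivity
  have h2 : (1 : ℝ) / Fintype.card K ≤ 1 := by
    rw [div_le_one (by positivity)]
    exact hqR.le
  exact div_le_div_of_nonneg_left (by positivity) (pow_pos (by linarith) _)
    (pow_le_pow_left₀ (by linarith) (by linarith) _)

/-- **Theorem 1, verbatim shape:** for `1 ≤ k < n` and `m ≤ q^k`,
`K(q, n, k, m) ≥ (1/2ⁿ) m^{n/k}`. [cite: DharDvirLund2021FurstenbergFiniteFields, Theorem 1 (§1, p. 2)] -/
theorem rpow_div_two_pow_le_furstenbergNumber {k m : ℕ} (hk : 1 ≤ k) (hkn : k < n)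
    (hm : m ≤ Fintype.card K ^ k) :
    (m : ℝ) ^ ((n : ℝ) / k) / 2 ^ n ≤ furstenbergNumber K n k m := by
  obtain ⟨S, hS, hF⟩ := exists_card_eq_furstenbergNumber hkn.le hm
  rw [← hS]
  exact rpow_div_two_pow_le_card hk hkn S hF

/-- Theorem 1 with the proof's constant: `K(q, n, k, m) ≥ m^{n/k}/(2 − q⁻¹)ⁿ`.
[cite: DharDvirLund2021FurstenbergFiniteFields, Theorem 1 (§1, p. 2) with Theorem 17 (p. 8)] -/
theorem rpow_div_pow_le_furstenbergNumber {k m : ℕ} (hk : 1 ≤ k) (hkn : k < n)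
    (hm : m ≤ Fintype.card K ^ k) :
    (m : ℝ) ^ ((n : ℝ) / k) / (2 - 1 / Fintype.card K) ^ n ≤ furstenbergNumber K n k m := by
  obtain ⟨S, hS, hF⟩ := exists_card_eq_furstenbergNumber hkn.le hm
  rw [← hS]
  exact rpow_div_pow_le_card hk hkn S hF

end MainTheorem

/-! ### §6: better bounds when `n` is divisible by `k` (Theorem 4) -/

section Divisible

variable [Fintype K] [DecidableEq K]

/-- **Theorem 4, the transfer step, for a given extension `L ⊇ 𝔽_q` of degree `k`** ("there exists
an `𝔽_q`-linear isomorphism between `𝔽_qⁿ` and `𝔽_{q^k}^r` […] any line in `𝔽_{q^k}^r` is a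
`k`-dimensional subspace in `𝔽_qⁿ`. This means `S` is a Kakeya set in `𝔽_{q^k}^r`. Using the Kakeya
bound (2) we have …", §6, p. 11): a `(k, m)`-Furstenberg set `S ⊆ 𝔽_q^{rk}`, read in `L^r` through
an `𝔽_q`-linear isomorphism, has at least `m` points on some line in every `L`-direction, so
Theorem 19 over `L` (with the indicator of `S` and `r = m`; `|L| = q^k`) gives
`(m/(2 − q^{−k}))^r ≤ |S|`. [cite: DharDvirLund2021FurstenbergFiniteFields, Theorem 4 (proof, §6, p. 11)] -/
theorem div_pow_le_card_of_extension {L : Type*} [Field L] [Fintype L] [DecidableEq L] [Algebra K L]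
    {k r m : ℕ} (hk : Module.finrank K L = k) (hr : 1 ≤ r) (S : Finset (Fin (r * k) → K))
    (hS : IsFurstenberg k m (S : Set (Fin (r * k) → K))) :
    ((m : ℝ) / (2 - 1 / (Fintype.card K : ℝ) ^ k)) ^ r ≤ S.card := by
  classical
  -- `𝔽_qⁿ ≅ 𝔽_{q^k}^r` as `𝔽_q`-vector spaces
  have hfr : Module.finrank K (Fin (r * k) → K) = Module.finrank K (Fin r → L) := by
    rw [Module.finrank_fintype_fun_eq_card, Fintype.card_fin, Module.finrank_pi_fintype,
      Finset.sum_const, card_univ, Fintype.card_fin, hk, smul_eq_mul]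
  let e : (Fin (r * k) → K) ≃ₗ[K] (Fin r → L) := LinearEquiv.ofFinrankEq _ _ hfr
  have hcardL : Fintype.card L = Fintype.card K ^ k := by
    rw [Module.card_eq_pow_finrank (K := K) (V := L), hk]
  -- the indicator of `e(S)`
  let f : (Fin r → L) → ℝ := fun z => if e.symm z ∈ S then 1 else 0
  -- every `L`-line in direction `v ≠ 0` is a translate of a rank-`k` `K`-subspace
  have hline : ∀ v : Fin r → L, v ≠ 0 → ∃ a : Fin r → L, (m : ℝ) ≤ ∑ t : L, |f (a + t • v)| := by
    intro v hv
    let ψ : L →ₗ[K] (Fin r → L) := (LinearMap.toSpanSingleton L (Fin r → L) v).restrictScalars K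
    have hψ : ∀ t, ψ t = t • v := fun t => rfl
    have hψinj : Function.Injective ψ := by
      intro s t hst
      rw [hψ, hψ] at hst
      have : (s - t) • v = 0 := by rw [sub_smul, hst, sub_self]
      exact sub_eq_zero.1 ((smul_eq_zero.1 this).resolve_right hv)
    set W := (LinearMap.range ψ).map (e.symm : (Fin r → L) →ₗ[K] (Fin (r * k) → K)) with hW
    have hWrank : Module.finrank K W = k := by
      rw [hW, LinearEquiv.finrank_map_eq, LinearMap.finrank_range_of_inj hψinj, hk]
    obtain ⟨x, hx⟩ := hS W hWrank
    refine ⟨e x, ?_⟩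
    -- the points of `S` on `x + W` correspond to the `t` with `e⁻¹(e x + t v) ∈ S`
    have hmem : ∀ y, y - x ∈ W ↔ ∃ t : L, y = e.symm (e x + t • v) := by
      intro y
      rw [hW, Submodule.mem_map_equiv, LinearMap.mem_range]
      simp only [LinearEquiv.symm_symm, hψ]
      constructor
      · rintro ⟨t, ht⟩
        refine ⟨t, ?_⟩
        apply e.injective
        rw [LinearEquiv.apply_symm_apply, ht, map_sub]
        abel
      · rintro ⟨t, ht⟩
        refine ⟨t, ?_⟩
        rw [ht, map_sub, LinearEquiv.apply_symm_apply]
        abel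
    have hcount : {y ∈ (S : Set (Fin (r * k) → K)) | y - x ∈ W}.ncard =
        (univ.filter fun t : L => e.symm (e x + t • v) ∈ S).card := by
      rw [ncard_sep_coe]
      refine (Finset.card_bij (fun t _ => e.symm (e x + t • v)) ?_ ?_ ?_).symm
      · intro t ht
        rw [mem_filter] at ht ⊢
        exact ⟨ht.2, (hmem _).2 ⟨t, rfl⟩⟩
      · intro s hs t ht hst
        have h1 := e.symm.injective hst
        exact hψinj (by rw [hψ, hψ]; exact add_left_cancel h1)
      · intro y hy
        rw [mem_filter] at hy
        obtain ⟨t, ht⟩ := (hmem y).1 hy.2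
        refine ⟨t, ?_, ht.symm⟩
        rw [mem_filter]
        exact ⟨mem_univ _, by rw [← ht]; exact hy.1⟩
    rw [hcount] at hx
    have hsum : ∑ t : L, |f (e x + t • v)| =
        ((univ.filter fun t : L => e.symm (e x + t • v) ∈ S).card : ℝ) := by
      rw [← Finset.sum_boole]
      refine Finset.sum_congr rfl fun t _ => ?_
      simp only [f]
      split_ifs <;> simp
    rw [hsum]
    exact_mod_cast hx
  -- Theorem 19 over `L = 𝔽_{q^k}` for the indicator of `e(S)` with `r = m`
  have h19 := div_pow_le_sum_abs_pow (K := L) f (Nat.cast_nonneg m) hline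
  have hval : ∀ z, |f z| ^ r = f z := by
    intro z
    simp only [f]
    split_ifs
    · simp
    · simp [zero_pow (by omega : r ≠ 0)]
  have hS' : ∑ z : Fin r → L, |f z| ^ r = S.card := by
    simp_rw [hval]
    simp only [f]
    rw [Finset.sum_boole]
    have : (univ.filter fun z : Fin r → L => e.symm z ∈ S) = S.map e.toEquiv.toEmbedding := by
      ext z
      simp [Finset.mem_map_equiv]
    rw [this, Finset.card_map]
  rw [hS'] at h19
  have hcast : (Fintype.card L : ℝ) = (Fintype.card K : ℝ) ^ k := by exact_mod_cast hcardL
  rw [hcast] at h19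
  exact h19

/-- Theorem 4 given the extension `L`: `m^{n/k}/2^{n/k} ≤ |S|` for `n = rk`
(as `2 − q^{−k} ≤ 2`). [cite: DharDvirLund2021FurstenbergFiniteFields, Theorem 4 (§1, p. 3; proof §6, p. 11)] -/
theorem rpow_div_two_rpow_le_card_of_extension {L : Type*} [Field L] [Fintype L] [DecidableEq L]
    [Algebra K L] {k r m : ℕ} (hk : Module.finrank K L = k) (hk1 : 1 ≤ k) (hr : 1 ≤ r)
    (S : Finset (Fin (r * k) → K)) (hS : IsFurstenberg k m (S : Set (Fin (r * k) → K))) :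
    (m : ℝ) ^ (((r * k : ℕ) : ℝ) / k) / 2 ^ (((r * k : ℕ) : ℝ) / k) ≤ S.card := by
  have h := div_pow_le_card_of_extension hk hr S hS
  have hq : (1 : ℝ) < Fintype.card K := by exact_mod_cast Fintype.one_lt_card
  have hkR : (k : ℝ) ≠ 0 := by exact_mod_cast (show k ≠ 0 by omega)
  have hexp : ((r * k : ℕ) : ℝ) / k = (r : ℕ) := by
    push_cast
    field_simp
  rw [hexp, Real.rpow_natCast, Real.rpow_natCast, ← div_pow]
  refine le_trans ?_ h
  have h1 : (0 : ℝ) < 1 / (Fintype.card K : ℝ) ^ k := by positivity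
  have h2 : (1 : ℝ) / (Fintype.card K : ℝ) ^ k ≤ 1 := by
    rw [div_le_one (by positivity)]
    exact one_le_pow₀ hq.le
  exact pow_le_pow_left₀ (by positivity) (div_le_div_of_nonneg_left (by positivity)
    (by linarith) (by linarith)) _


omit [DecidableEq K] in
/-- "Note there exists an `𝔽_q`-linear isomorphism between `𝔽_qⁿ` and `𝔽^r_{q^k}`. This quickly
follows from the fact `𝔽_{q^k}` is by definition `𝔽_q[x]/I` where `I` is a principal ideal generated
by a degree `k` irreducible polynomial in `𝔽_q[x]`" (§6, p. 11): the degree-`k` extension of a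
finite field exists — here realised as Mathlib's `GaloisField p (sk)` (`|𝔽_q| = p^s`) made an
`𝔽_q`-algebra through `FiniteField.nonempty_algHom_of_finrank_dvd`, its `𝔽_q`-dimension read off
from `|𝔽_{q^k}| = q^k`. [cite: DharDvirLund2021FurstenbergFiniteFields, Theorem 4 (proof, §6, p. 11)] -/
theorem exists_extension_finrank_eq (K : Type*) [Field K] [Fintype K] {k : ℕ} (hk : 1 ≤ k) :
    ∃ (L : Type) (_ : Field L) (_ : Fintype L) (_ : Algebra K L), Module.finrank K L = k := by
  classical
  obtain ⟨p, hchar, s, hp, hK⟩ := FiniteField.card' K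
  haveI : CharP K p := hchar
  haveI : Fact p.Prime := ⟨hp⟩
  letI : Algebra (ZMod p) K := ZMod.algebra K p
  haveI : Fintype (GaloisField p (s * k)) := Fintype.ofFinite _
  have hsk : (s : ℕ) * k ≠ 0 := Nat.mul_ne_zero s.ne_zero (by omega)
  have hKrank : Module.finrank (ZMod p) K = s := by
    have h := Module.card_eq_pow_finrank (K := ZMod p) (V := K)
    rw [ZMod.card, hK] at h
    exact (Nat.pow_right_injective hp.two_le h).symm
  have hLrank : Module.finrank (ZMod p) (GaloisField p (s * k)) = s * k := GaloisField.finrank p hsk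
  obtain ⟨φ⟩ := FiniteField.nonempty_algHom_of_finrank_dvd (F := ZMod p) (K := K)
    (L := GaloisField p (s * k)) (by rw [hKrank, hLrank]; exact dvd_mul_right _ _)
  letI : Algebra K (GaloisField p (s * k)) := φ.toRingHom.toAlgebra
  refine ⟨GaloisField p (s * k), inferInstance, inferInstance, inferInstance, ?_⟩
  have hL : Fintype.card (GaloisField p (s * k)) =
      Fintype.card K ^ Module.finrank K (GaloisField p (s * k)) := Module.card_eq_pow_finrank
  have hL' : Fintype.card (GaloisField p (s * k)) = p ^ ((s : ℕ) * k) := by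
    rw [Module.card_eq_pow_finrank (K := ZMod p) (V := GaloisField p (s * k)), ZMod.card, hLrank]
  rw [hL', hK, ← pow_mul] at hL
  exact (Nat.eq_of_mul_eq_mul_left s.pos (Nat.pow_right_injective hp.two_le hL)).symm

/-- **Theorem 4:** "Let `q` be a prime power, and let `n, k` and `m` be positive integers such
that `m ≤ q^k` and `n` is divisible by `k`, we have `K(q, n, k, m) ≥ (1/2^{n/k}) m^{n/k}`" — in the
form: every `(k, m)`-Furstenberg `S ⊆ 𝔽_qⁿ` with `1 ≤ k ∣ n`, `n ≥ 1` has `m^{n/k}/2^{n/k} ≤ |S|`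
(see `rpow_div_two_rpow_le_furstenbergNumber_of_dvd` for `K(q, n, k, m)`).
[cite: DharDvirLund2021FurstenbergFiniteFields, Theorem 4 (§1, p. 3)] -/
theorem rpow_div_two_rpow_le_card_of_dvd {n k m : ℕ} (hk : 1 ≤ k) (hkn : k ∣ n) (hn : 1 ≤ n)
    (S : Finset (Fin n → K)) (hS : IsFurstenberg k m (S : Set (Fin n → K))) :
    (m : ℝ) ^ ((n : ℝ) / k) / 2 ^ ((n : ℝ) / k) ≤ S.card := by
  classical
  obtain ⟨r, hr⟩ := hkn
  obtain rfl : n = r * k := by rw [hr, mul_comm]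
  have hr1 : 1 ≤ r := by
    rcases Nat.eq_zero_or_pos r with h | h
    · subst h; simp at hn
    · exact h
  obtain ⟨L, instF, instFt, instA, hL⟩ := exists_extension_finrank_eq K hk
  letI := instF
  letI := instFt
  letI := instA
  exact rpow_div_two_rpow_le_card_of_extension hL hk hr1 S hS

/-- **Theorem 4, verbatim shape:** for positive `n, k, m` with `m ≤ q^k` and `k ∣ n`,
`K(q, n, k, m) ≥ (1/2^{n/k}) m^{n/k}`. [cite: DharDvirLund2021FurstenbergFiniteFields, Theorem 4 (§1, p. 3)] -/
theorem rpow_div_two_rpow_le_furstenbergNumber_of_dvd {n k m : ℕ} (hk : 1 ≤ k) (hkn : k ∣ n)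
    (hn : 1 ≤ n) (hm : m ≤ Fintype.card K ^ k) :
    (m : ℝ) ^ ((n : ℝ) / k) / 2 ^ ((n : ℝ) / k) ≤ furstenbergNumber K n k m := by
  obtain ⟨S, hS, hF⟩ := exists_card_eq_furstenbergNumber (Nat.le_of_dvd hn hkn) hm
  rw [← hS]
  exact rpow_div_two_rpow_le_card_of_dvd hk hkn hn S hF

end Divisible

/-! ### §1: "A `(1, q)`-Furstenberg set is called a Kakeya set" -/

section KakeyaBridge

variable {n : ℕ} [Fintype K]

omit [Fintype K] in
/-- A rank-one subspace is the span of a nonzero vector. [folklore] -/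
private theorem exists_eq_span_singleton_of_finrank_eq_one {W : Submodule K (Fin n → K)}
    (hW : Module.finrank K W = 1) : ∃ v : Fin n → K, v ≠ 0 ∧ W = K ∙ v := by
  obtain ⟨v, hv0, hv⟩ := finrank_eq_one_iff'.1 hW
  refine ⟨(v : Fin n → K), fun h => hv0 (Subtype.ext h), ?_⟩
  ext y
  rw [Submodule.mem_span_singleton]
  constructor
  · intro hy
    obtain ⟨c, hc⟩ := hv ⟨y, hy⟩
    exact ⟨c, by rw [← Submodule.coe_smul, hc]⟩
  · rintro ⟨c, rfl⟩
    exact W.smul_mem c v.2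

/-- **"A `(1, q)`-Furstenberg set is called a Kakeya set"** (§1, p. 1): for `S ⊆ 𝔽_qⁿ`, `n ≥ 1`,
`IsFurstenberg 1 q S ↔ IsKakeya S` (the Kakeya sets of `FiniteFieldKakeya.lean`, Dvir's
definition: a line in every direction) — a translate of the line `𝔽_q v` with `q` points of `S` is
contained in `S`. [cite: DharDvirLund2021FurstenbergFiniteFields, §1 (p. 1)] -/
theorem isFurstenberg_one_card_iff_isKakeya (hn : 1 ≤ n) (S : Set (Fin n → K)) :
    IsFurstenberg 1 (Fintype.card K) S ↔ IsKakeya S := by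
  classical
  have hq1 : 1 ≤ Fintype.card K := Fintype.card_pos
  -- the line `x + tv` as a set, with `q` points
  have hline : ∀ (x v : Fin n → K), v ≠ 0 →
      (Set.range fun t : K => x + t • v).ncard = Fintype.card K := by
    intro x v hv
    rw [Set.ncard_range_of_injective, Nat.card_eq_fintype_card]
    intro s t hst
    exact smul_left_injective K hv (add_left_cancel hst)
  constructor
  · intro hS v
    by_cases hv : v = 0
    · obtain ⟨b, hb⟩ := hS.nonempty hq1 hn
      exact ⟨b, fun a => by simpa [hv] using hb⟩
    obtain ⟨x, hx⟩ := hS (K ∙ v) (finrank_span_singleton hv)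
    refine ⟨x, fun a => ?_⟩
    have hsub : {y ∈ S | y - x ∈ K ∙ v} ⊆ Set.range fun t : K => x + t • v := by
      intro y hy
      obtain ⟨t, ht⟩ := Submodule.mem_span_singleton.1 hy.2
      refine ⟨t, ?_⟩
      show x + t • v = y
      rw [ht]
      abel
    have heq := Set.eq_of_subset_of_ncard_le hsub (by rw [hline x v hv]; exact hx)
      (Set.finite_range _)
    have : x + a • v ∈ {y ∈ S | y - x ∈ K ∙ v} := by
      rw [heq]
      exact ⟨a, rfl⟩
    exact this.1
  · intro hS W hW
    obtain ⟨v, hv, rfl⟩ := exists_eq_span_singleton_of_finrank_eq_one hW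
    obtain ⟨b, hb⟩ := hS v
    refine ⟨b, ?_⟩
    have hsub : (Set.range fun t : K => b + t • v) ⊆ {y ∈ S | y - b ∈ K ∙ v} := by
      rintro y ⟨t, rfl⟩
      refine ⟨hb t, Submodule.mem_span_singleton.2 ⟨t, ?_⟩⟩
      show t • v = b + t • v - b
      abel
    rw [← hline b v hv]
    exact Set.ncard_le_ncard hsub (Set.toFinite _)

/-- **Eq. (1):** "`K(q, n, 1, q) ≥ 2^{−n} qⁿ`" — the Kakeya bound of Dvir–Kopparty–Saraf–Sudan
(`FiniteFieldKakeya.half_pow_le_card_of_isKakeya`) read through the dictionary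
`isFurstenberg_one_card_iff_isKakeya`. [cite: DharDvirLund2021FurstenbergFiniteFields, §1 (eq. (1), p. 1)] -/
theorem div_two_pow_le_furstenbergNumber_one (hn : 1 ≤ n) :
    ((Fintype.card K : ℝ) / 2) ^ n ≤ furstenbergNumber K n 1 (Fintype.card K) := by
  classical
  obtain ⟨S, hS, hF⟩ := exists_card_eq_furstenbergNumber (K := K) hn (by rw [pow_one])
  rw [← hS]
  exact half_pow_le_card_of_isKakeya ((isFurstenberg_one_card_iff_isKakeya hn _).1 hF)

end KakeyaBridge

end Furstenberg

end Literature.Combinatorics.Kakeya
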